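import Mathlib.MeasureTheory.Integral.Bochner.Basic
import Mathlib.MeasureTheory.Integral.Lebesgue.Countable
import Mathlib.Analysis.Normed.Lp.MeasurableSpace
import Literature.Analysis.FluidPDE.HardSphereDynamicsProofs
import Literature.Analysis.FluidPDE.HardSphereRegularGeometry
import HarnessLib

/-!
# Collision records of a hard-sphere trajectory: marks, collision sums, the empirical
collision measure, the collision DAG and the coarse past

For a hard-sphere trajectory `γ : ℝ → Config N d X` (`IsHardSphereTrajectory G ε N γ`,
Gallagher–Saint-Raymond–Texier 2013 Def. 4.1.2: locally finitely many collision times, at each of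
which exactly one pair `{i, j}` is in contact, with pre-collisional left limit and
post-collisional right-continuous value) the *collision record* is the finite list of collisions
`(t_m, (p_m, q_m))` in a time window (Aoki–Pulvirenti–Simonella–Tsuji 2015 §5), each decorated
with its *marks*: position, impact direction `ω = ε⁻¹ (x_i - x_j)`, pre- and post-collisional
velocities of the pair. This file provides that vocabulary once, so that route statements need
not inline the `∑ᶠ`/contact-pair bookkeeping:

* `contactPairs G ε z` — the ORDERED pairs `(i, j)`, `i ≠ j`, in contact in `z`
  (`z ∈ contactSet G N ε i j`); each binary collision of a trajectory in a regular geometry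
  contributes the two pairs `(p, q), (q, p)` (`IsHardSphereTrajectory.contactPairs_eq_pair`).
  `sum_contactPairs_eq` identifies `∑ p ∈ contactPairs, f` with the inline form
  `∑ i, ∑ j, if i ≠ j ∧ ‖G.sepVec x_i x_j‖ = ε then f i j else 0`.
  (`Literature.MathematicalPhysics.KineticTheory.contactPairSet G ε z`, the UNORDERED event of
  `z`, is the image of `contactPairs G ε z` under `Sym2.mk`.)
* `HardSphereCollisionRecord d X N` — the record of one collision: time, ordered pair, the two
  positions, impact vector, pre- and post-collisional velocities of the pair;
  `HardSphereCollisionRecord.ofConfig G ε z t i j` computes it from the (right-continuous,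
  post-collisional) configuration `z = γ t`, the pre-collisional velocities being recovered by
  the involution `reflectVel` (they ARE the velocities of the left limit `Function.leftLim γ t`,
  `IsHardSphereTrajectory.ofConfig_preVel_eq_leftLim`); `.mark = (t, x_i, ω, v_i⁻, v_j⁻)`,
  `.outDir = (v_i⁺ - v_j⁺)/|v_i⁺ - v_j⁺|`.
* `collisionPairSum G ε γ S g = ∑ᶠ t ∈ collisionTimes ∩ S, ∑ (i,j) ∈ contactPairs (γ t), g t i j`
  and its record form `collisionSum G ε γ S F`; `collisionTriples` (the set of `(t, i, j)`);
  the marked point measure `collisionMeasure G ε γ S = Σ δ_{mark}` on `ℝ × X × ℝ^d × ℝ^d × ℝ^d`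
  with `lintegral_collisionMeasure` / `integral_collisionMeasure`; flow versions
  `HardSphereFlow.collisionPairSum`, `HardSphereFlow.collisionSum`,
  `HardSphereFlow.empiricalCollisionMeasure` (UNNORMALISED: route statements multiply by their
  own `ε/(N+1)` or `N⁻¹`).
* participation and flights: `Collide`, `Participates`, `collisionTimesOf G ε γ k`,
  `partner G ε z i`, `flightStart G ε γ a k t` (the last collision time of `k` in `(a, t)`, else
  `a`: the start of the free flight of `k` current at time `t`), the enumerators
  `nextTimeAfter`, `nthTimeAfter`, `nthCollisionTime`, `nthCollisionTimeOf`.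
* the COLLISION DAG of a trajectory on the window `(a, ∞)`: vertices = collision times `> a`
  (one collision per time by `IsHardSphereTrajectory.binary`), an edge `s → t` carried by
  particle `k` when `s < t` are consecutive collisions of `k` (`IsDagEdgeVia`, `IsDagEdge`;
  in-degree ≤ 2: `IsHardSphereTrajectory.isDagEdge_iff`); directed paths `dagPathsTo`,
  `dagPaths`, the path count `pathCount` (the depth-`m` ancestor multiset of `t` is
  `s ↦ pathCount m s t`), `backwardClusterToDepth`, `ancestry`, the census of ordered path pairs
  from a common ancestor `pathPairCount`, the FRESH / RING dichotomy `IsFresh m t`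
  (the depth-`m` backward clusters of the two partners are disjoint) and tree ancestry
  `IsTreeToDepth m t` — the parent structure a Bayesian-network / information-percolation
  argument consumes (Polyanskiy–Wu 2017 §5).
* along a `HardSphereFlow Φ`, as functions of the initial datum `z`: the `n`-th collision of
  particle `i` (`nthCollisionTimeOf`, `nthPartnerOf`, `nthRecordOf`) and its COARSE PAST
  `coarsePastOf q i n z` — the `q`-coarse-grained positions and exact velocities of ALL particles
  at the starts of the current flights of `i` and of its partner — with the generated σ-algebra
  `coarsePastSigma = MeasurableSpace.comap (coarsePastOf q i n)` on `Config N d X`, so that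
  `ProbabilityTheory.condDistrib (impact vector) (coarse past, pre-velocities) P` and
  `MeasureTheory.condExp` given the coarse past are typable; `coarseConfig`, `Torus.coarseCell r`.

## Mathlib / Literature reuse

`finsum`, `Finset.sum_finset_product`, `Measure.dirac`, `lintegral_dirac`, `integral_dirac`,
`integral_finsetSum_measure`, `Function.leftLim`, `sSup`/`sInf` on `ℝ`, `Set.ncard`,
`MeasurableSpace.comap` are Mathlib's; the trajectory kit (`collisionTimes`, `contactSet`,
`collidePair`, `reflectVel`, `IsHardSphereTrajectory.binary`, `eq_collidePair_leftLim`,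
`Geometry.IsHardSphereRegular.mem_contactSet_comm`) is `HardSpherePhaseSpace` /
`HardSphereDynamics(Proofs)` / `HardSphereRegularGeometry`. The APST backward cluster OF
PARTICLES over a time window and the recollision count are
`Literature.MathematicalPhysics.KineticTheory.backwardCluster` / `recollisionCount`
(file `KineticTheory/BackwardCluster`, not imported to keep `FluidPDE` below `KineticTheory`);
the depth-graded ancestry OF COLLISIONS defined here is the different, DAG notion. Mathlib's
`Digraph`/`SimpleGraph` are not used: the vertex set is a (finite) set of reals depending on the
trajectory and only paths/ancestry are consumed, which are shortest stated directly.

## Design choices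

* ORDERED pairs. Impact vector and `(v_i⁻, v_j⁻)` are orientation dependent, and the route
  statements (`CollisionMeasureChaos`) sum over ordered contact pairs; a binary collision thus
  appears twice, as `(p, q)` and `(q, p)` (`ω ↦ -ω`, velocities swapped). Once-per-collision sums
  are `collisionSum … fun c => if c.fst < c.snd then … else 0`
  (`IsHardSphereTrajectory.collisionSum_ite_lt_eq_numCollisions`).
* Pre-collisional data are read off the right-continuous value through the involution
  `collidePair G i j` / `reflectVel` rather than through `Function.leftLim`, so that no topology
  is needed to DEFINE them; the identification with left limits is a theorem (Hausdorff `X`).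
* Windows are arbitrary sets of times `S` (routes use `Icc 0 τ` and `Ioc 0 τ`); finiteness
  lemmas ask `(collisionTimes G ε γ ∩ S).Finite`, automatic for bounded `S` on a trajectory.
* DAG vertices are collision TIMES: legitimate because a hard-sphere trajectory has one
  collision per collision time; for a general curve simultaneous collisions are merged.
  The window start `a` truncates the past (initial data at time `a`); the `N` initial vertices
  of the informal picture are not materialised — a partner with no earlier collision in the
  window simply has an empty backward cluster (`flightStart = a`).
* Junk values (documented at each definition): `finsum` of an infinite support is `0`;
  `sInf ∅ = sSup ∅ = 0` in `ℝ`; `partner z i = i` when `i` touches nobody; `Set.ncard` of an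
  infinite set is `0`; flow-level functions are meaningful on `Φ.good` only.
* Deliberately NOT here: measurability in the initial datum of the flow-level maps (it needs
  joint measurability of `(t, z) ↦ Φ_t z`, cf. `HardSphereFlowMeasurable`), normalisations, and
  any statement about laws (chaos, percolation bounds) — those are route items.

## References

* I. Gallagher, L. Saint-Raymond, B. Texier, *From Newton to Boltzmann* (2013), §4.1,
  Def. 4.1.2, Prop. 4.1.1 (collisions of the hard-sphere flow; binary a.e.).
* K. Aoki, M. Pulvirenti, S. Simonella, T. Tsuji, *Backward clusters, hierarchy and wild sums for
  a hard sphere system in a low-density regime*, M3AS 25 (2015), §5 (the collision record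
  `{t_m}, {(p_m, q_m)}` of a trajectory), §1 (backward clusters).
* M. Pulvirenti, S. Simonella, *On the evolution of the empirical measure for the hard-sphere
  dynamics*, arXiv:1504.03215 (2015) (empirical measures along one trajectory).
* Y. Polyanskiy, Y. Wu, *Strong data-processing inequalities for channels and Bayesian
  networks* (2017), §5 (percolation of information needs the parent structure of the DAG).
-/

open Set Filter Function MeasureTheory
open scoped Topology ENNReal

namespace Literature.Analysis.FluidPDE

noncomputable section

/-! ## The record of one collision -/

/-- The **record of one collision** of a system of `N` hard spheres with positions in `X` and
velocities in `ℝ^d`: its time, the ORDERED colliding pair `(fst, snd)`, the positions of the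
two partners, the impact vector `ω = ε⁻¹ (x_fst - x_snd)` (a unit vector at contact), and the
pre- and post-collisional velocities `(v_fst, v_snd)` of the pair (GST 2013 §4.1: a collision of
the hard-sphere flow is the datum of its time, pair, impact direction and incoming/outgoing
velocities `ν^{i,j} = (x_i - x_j)/|x_i - x_j|`, `v^{in}`, `v^{out}`; APST 2015 §5 records
`(t_m, (p_m, q_m))`). [cite: GST2013, §4.1] -/
structure HardSphereCollisionRecord (d : Type*) (X : Type*) (N : ℕ) where
  /-- The collision time. -/
  time : ℝ
  /-- The first particle of the (ordered) colliding pair. -/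
  fst : Fin N
  /-- The second particle of the (ordered) colliding pair. -/
  snd : Fin N
  /-- The position of the first particle at the collision. -/
  fstPos : X
  /-- The position of the second particle at the collision. -/
  sndPos : X
  /-- The impact vector `ω = ε⁻¹ (x_fst - x_snd)`. -/
  impactVec : EuclideanSpace ℝ d
  /-- The pre-collisional (incoming) velocities `(v_fst⁻, v_snd⁻)`. -/
  preVel : EuclideanSpace ℝ d × EuclideanSpace ℝ d
  /-- The post-collisional (outgoing) velocities `(v_fst⁺, v_snd⁺)`. -/
  postVel : EuclideanSpace ℝ d × EuclideanSpace ℝ d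

section Kinetic

variable {d : Type*} [Fintype d] {X : Type*} {N : ℕ}

namespace HardSphereCollisionRecord

omit [Fintype d] in
/-- The **mark** of a collision record: `(t, x_fst, ω, v_fst⁻, v_snd⁻)` — the point of
`ℝ × X × ℝ^d × ℝ^d × ℝ^d` at which the empirical collision measure puts a Dirac mass (the
variables `(t, x, ω, v, v_*)` of the collision integrals of kinetic theory). [folklore] -/
def mark (c : HardSphereCollisionRecord d X N) :
    ℝ × X × EuclideanSpace ℝ d × EuclideanSpace ℝ d × EuclideanSpace ℝ d :=
  (c.time, c.fstPos, c.impactVec, c.preVel.1, c.preVel.2)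

omit [Fintype d] in
/-- The unordered colliding pair `{fst, snd}` of a record. [folklore] -/
def pair (c : HardSphereCollisionRecord d X N) : Finset (Fin N) := {c.fst, c.snd}

/-- The outgoing relative direction `ĝ_out = (v_fst⁺ - v_snd⁺) / |v_fst⁺ - v_snd⁺|` of a record
(junk value `0` if the post-collisional velocities coincide). [folklore] -/
def outDir (c : HardSphereCollisionRecord d X N) : EuclideanSpace ℝ d :=
  ‖c.postVel.1 - c.postVel.2‖⁻¹ • (c.postVel.1 - c.postVel.2)

/-- The incoming relative direction `ĝ_in = (v_fst⁻ - v_snd⁻) / |v_fst⁻ - v_snd⁻|` of a record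
(junk value `0` if the pre-collisional velocities coincide). [folklore] -/
def inDir (c : HardSphereCollisionRecord d X N) : EuclideanSpace ℝ d :=
  ‖c.preVel.1 - c.preVel.2‖⁻¹ • (c.preVel.1 - c.preVel.2)

omit [Fintype d] in
/-- Unfolding lemma for the mark. [folklore] -/
@[simp]
theorem mark_def (c : HardSphereCollisionRecord d X N) :
    c.mark = (c.time, c.fstPos, c.impactVec, c.preVel.1, c.preVel.2) := rfl

/-- The outgoing direction is a unit vector as soon as the post-collisional velocities differ.
[folklore] -/
theorem norm_outDir {c : HardSphereCollisionRecord d X N} (h : c.postVel.1 ≠ c.postVel.2) :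
    ‖c.outDir‖ = 1 := by
  have hne : ‖c.postVel.1 - c.postVel.2‖ ≠ 0 := norm_ne_zero_iff.2 (sub_ne_zero.2 h)
  rw [outDir, norm_smul, norm_inv, norm_norm, inv_mul_cancel₀ hne]

/-- The incoming direction is a unit vector as soon as the pre-collisional velocities differ.
[folklore] -/
theorem norm_inDir {c : HardSphereCollisionRecord d X N} (h : c.preVel.1 ≠ c.preVel.2) :
    ‖c.inDir‖ = 1 := by
  have hne : ‖c.preVel.1 - c.preVel.2‖ ≠ 0 := norm_ne_zero_iff.2 (sub_ne_zero.2 h)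
  rw [inDir, norm_smul, norm_inv, norm_norm, inv_mul_cancel₀ hne]

/-- The record of the collision of the ordered pair `(i, j)` at time `t` read off the
configuration `z` (for a right-continuous hard-sphere trajectory, `z = γ t` is the
POST-collisional configuration): positions and post-collisional velocities are those of `z`,
the impact vector is `ε⁻¹ (x_i - x_j)` (`Geometry.sepVec`), and the pre-collisional velocities
are recovered by the involution `reflectVel (x_i - x_j)` of the elastic law
(`reflectVel_reflectVel`; they are the velocities of the left limit,
`IsHardSphereTrajectory.ofConfig_preVel_eq_leftLim`). [folklore] -/
@[simps]
def ofConfig (G : Geometry d X) (ε : ℝ) (z : Config N d X) (t : ℝ) (i j : Fin N) :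
    HardSphereCollisionRecord d X N where
  time := t
  fst := i
  snd := j
  fstPos := (z i).1
  sndPos := (z j).1
  impactVec := ε⁻¹ • G.sepVec (z i).1 (z j).1
  preVel := reflectVel (G.sepVec (z i).1 (z j).1) ((z i).2, (z j).2)
  postVel := ((z i).2, (z j).2)

/-- At contact (and `0 < ε`) the impact vector is a unit vector. [folklore] -/
theorem norm_ofConfig_impactVec {G : Geometry d X} {ε : ℝ} (hε : 0 < ε) {z : Config N d X}
    (t : ℝ) {i j : Fin N} (hc : z ∈ contactSet G N ε i j) :
    ‖(ofConfig G ε z t i j).impactVec‖ = 1 := by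
  rw [ofConfig_impactVec, norm_smul, norm_inv, Real.norm_of_nonneg hε.le, (mem_contactSet.1 hc).2,
    inv_mul_cancel₀ hε.ne']

/-- The pre-collisional velocities of the record are those of the configuration
`collidePair G i j z` obtained by undoing the elastic jump (for `i ≠ j`). [folklore] -/
theorem ofConfig_preVel_eq_collidePair (G : Geometry d X) (ε : ℝ) (z : Config N d X) (t : ℝ)
    {i j : Fin N} (hij : i ≠ j) :
    (ofConfig G ε z t i j).preVel = ((collidePair G i j z i).2, (collidePair G i j z j).2) := by
  rw [collidePair_apply_left hij, collidePair_apply_right, ofConfig_preVel]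

/-- Momentum of the pair is the same before and after: `v_i⁻ + v_j⁻ = v_i⁺ + v_j⁺`. [folklore] -/
theorem ofConfig_preVel_fst_add_snd (G : Geometry d X) (ε : ℝ) (z : Config N d X) (t : ℝ)
    (i j : Fin N) :
    (ofConfig G ε z t i j).preVel.1 + (ofConfig G ε z t i j).preVel.2 =
      (ofConfig G ε z t i j).postVel.1 + (ofConfig G ε z t i j).postVel.2 := by
  simp only [ofConfig_preVel, ofConfig_postVel]
  exact reflectVel_fst_add_reflectVel_snd _ _

/-- Kinetic energy of the pair is the same before and after. [folklore] -/
theorem ofConfig_norm_sq_preVel (G : Geometry d X) (ε : ℝ) (z : Config N d X) (t : ℝ)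
    (i j : Fin N) :
    ‖(ofConfig G ε z t i j).preVel.1‖ ^ 2 + ‖(ofConfig G ε z t i j).preVel.2‖ ^ 2 =
      ‖(ofConfig G ε z t i j).postVel.1‖ ^ 2 + ‖(ofConfig G ε z t i j).postVel.2‖ ^ 2 := by
  simp only [ofConfig_preVel, ofConfig_postVel]
  exact norm_sq_reflectVel_fst_add_norm_sq_reflectVel_snd _ _

end HardSphereCollisionRecord

/-! ## Ordered contact pairs of a configuration -/

open scoped Classical in
/-- The ORDERED pairs `(i, j)` of distinct particles in contact in the configuration `z`
(`z ∈ contactSet G N ε i j`, i.e. `z ∈ D_ε^N` and `‖x_i - x_j‖ = ε`). Along a hard-sphere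
trajectory this is nonempty exactly at the collision times (`Kinetic.collisionTimes`), where in
a regular geometry it consists of the colliding pair in its two orders
(`IsHardSphereTrajectory.contactPairs_eq_pair`); the unordered event
`KineticTheory.contactPairSet G ε z` is its image under `Sym2.mk`. [folklore] -/
def contactPairs (G : Geometry d X) (ε : ℝ) (z : Config N d X) : Finset (Fin N × Fin N) :=
  Finset.univ.filter fun p => p.1 ≠ p.2 ∧ z ∈ contactSet G N ε p.1 p.2

section ContactPairs

variable {G : Geometry d X} {ε : ℝ}

/-- Membership in the ordered contact pairs. [folklore] -/
theorem mem_contactPairs {z : Config N d X} {p : Fin N × Fin N} :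
    p ∈ contactPairs G ε z ↔ p.1 ≠ p.2 ∧ z ∈ contactSet G N ε p.1 p.2 := by
  classical
  simp [contactPairs]

/-- Inside the hard-sphere domain, `(i, j)` is a contact pair iff `i ≠ j` and `‖x_i - x_j‖ = ε`
(the condition inlined in route statements). [folklore] -/
theorem mem_contactPairs_iff_of_mem {z : Config N d X} (hz : z ∈ hardSphereDomain G N ε)
    {p : Fin N × Fin N} :
    p ∈ contactPairs G ε z ↔ p.1 ≠ p.2 ∧ ‖G.sepVec (z p.1).1 (z p.2).1‖ = ε := by
  rw [mem_contactPairs, mem_contactSet, and_iff_right hz]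

/-- **The inline form.** Inside the hard-sphere domain a sum over the ordered contact pairs is
the double sum `∑ i, ∑ j, if i ≠ j ∧ ‖x_i - x_j‖ = ε then f i j else 0` used verbatim by the
route statements this file serves. [folklore] -/
theorem sum_contactPairs_eq {M : Type*} [AddCommMonoid M] {z : Config N d X}
    (hz : z ∈ hardSphereDomain G N ε) (f : Fin N → Fin N → M) :
    ∑ p ∈ contactPairs G ε z, f p.1 p.2 =
      ∑ i, ∑ j, if i ≠ j ∧ ‖G.sepVec (z i).1 (z j).1‖ = ε then f i j else 0 := by
  classical
  have hfilter : contactPairs G ε z =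
      Finset.univ.filter fun p : Fin N × Fin N => p.1 ≠ p.2 ∧ ‖G.sepVec (z p.1).1 (z p.2).1‖ = ε :=
    Finset.filter_congr fun p _ => by rw [mem_contactSet, and_iff_right hz]
  rw [hfilter, Finset.sum_filter, Fintype.sum_prod_type]

/-- The ordered contact pairs only depend on the positions. [folklore] -/
theorem contactPairs_congr_fst {z z' : Config N d X} (h : ∀ k, (z k).1 = (z' k).1) :
    contactPairs G ε z = contactPairs G ε z' := by
  ext p
  rw [mem_contactPairs, mem_contactPairs, mem_contactSet_congr_fst h]

/-- Undoing the elastic jump of a pair does not change the contact pairs (positions are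
unchanged). [folklore] -/
@[simp]
theorem contactPairs_collidePair (i j : Fin N) (z : Config N d X) :
    contactPairs G ε (collidePair G i j z) = contactPairs G ε z :=
  contactPairs_congr_fst fun k => collidePair_apply_fst z k

/-- A time is a collision time of a curve iff some ordered pair is in contact. [folklore] -/
theorem mem_collisionTimes_iff_contactPairs_nonempty {γ : ℝ → Config N d X} {t : ℝ} :
    t ∈ collisionTimes G ε γ ↔ (contactPairs G ε (γ t)).Nonempty := by
  rw [mem_collisionTimes]
  constructor
  · rintro ⟨i, j, hij, hc⟩
    exact ⟨(i, j), mem_contactPairs.2 ⟨hij, hc⟩⟩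
  · rintro ⟨p, hp⟩
    exact ⟨p.1, p.2, (mem_contactPairs.1 hp).1, (mem_contactPairs.1 hp).2⟩

/-- If an ordered pair is in contact at time `t`, then `t` is a collision time. [folklore] -/
theorem mem_collisionTimes_of_mem_contactPairs {γ : ℝ → Config N d X} {t : ℝ}
    {p : Fin N × Fin N} (hp : p ∈ contactPairs G ε (γ t)) : t ∈ collisionTimes G ε γ :=
  mem_collisionTimes_iff_contactPairs_nonempty.2 ⟨p, hp⟩

/-- Off the collision times there is no contact pair. [folklore] -/
theorem contactPairs_eq_empty_of_not_mem {γ : ℝ → Config N d X} {t : ℝ}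
    (ht : t ∉ collisionTimes G ε γ) : contactPairs G ε (γ t) = ∅ := by
  rw [← Finset.not_nonempty_iff_eq_empty]
  exact fun h => ht (mem_collisionTimes_iff_contactPairs_nonempty.2 h)

/-- In a regular geometry contact is symmetric: `(j, i)` is a contact pair iff `(i, j)` is.
[folklore] -/
theorem swap_mem_contactPairs_iff [TopologicalSpace X] (hG : G.IsHardSphereRegular ε)
    {z : Config N d X} {p : Fin N × Fin N} :
    p.swap ∈ contactPairs G ε z ↔ p ∈ contactPairs G ε z := by
  rw [mem_contactPairs, mem_contactPairs, Prod.fst_swap, Prod.snd_swap, ne_comm,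
    hG.mem_contactSet_comm]

end ContactPairs

/-! ## Collision triples, collision sums and the collision measure of a curve -/

section Sums

variable {G : Geometry d X} {ε : ℝ}

/-- The **collision triples** of the curve `γ` with times in `S`: the triples `(t, i, j)` with
`t ∈ S` and `(i, j)` an ordered pair in contact at time `t` (then `t` is a collision time,
`mem_collisionTimes_of_mem_contactPairs`). This is the ordered version of the collision record
`{(t_m, {p_m, q_m})}` of APST 2015 §5. [cite: AokiPulvirentiSimonellaTsuji2015, §5] -/
def collisionTriples (G : Geometry d X) (ε : ℝ) (γ : ℝ → Config N d X) (S : Set ℝ) :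
    Set (ℝ × Fin N × Fin N) :=
  {e | e.1 ∈ S ∧ e.2 ∈ contactPairs G ε (γ e.1)}

/-- Membership in the collision triples. [folklore] -/
theorem mem_collisionTriples {γ : ℝ → Config N d X} {S : Set ℝ} {e : ℝ × Fin N × Fin N} :
    e ∈ collisionTriples G ε γ S ↔ e.1 ∈ S ∧ e.2 ∈ contactPairs G ε (γ e.1) := Iff.rfl

/-- The time of a collision triple is a collision time in the window. [folklore] -/
theorem fst_mem_of_mem_collisionTriples {γ : ℝ → Config N d X} {S : Set ℝ}
    {e : ℝ × Fin N × Fin N} (he : e ∈ collisionTriples G ε γ S) :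
    e.1 ∈ collisionTimes G ε γ ∩ S :=
  ⟨mem_collisionTimes_of_mem_contactPairs he.2, he.1⟩

/-- The collision triples lie over the collision times of the window. [folklore] -/
theorem collisionTriples_subset_prod (γ : ℝ → Config N d X) (S : Set ℝ) :
    collisionTriples G ε γ S ⊆ (collisionTimes G ε γ ∩ S) ×ˢ univ :=
  fun _ he => ⟨fst_mem_of_mem_collisionTriples he, mem_univ _⟩

/-- Finitely many collision times in the window give finitely many collision triples. [folklore] -/
theorem finite_collisionTriples {γ : ℝ → Config N d X} {S : Set ℝ}
    (hfin : (collisionTimes G ε γ ∩ S).Finite) : (collisionTriples G ε γ S).Finite :=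
  (hfin.prod finite_univ).subset (collisionTriples_subset_prod γ S)

/-- The **collision pair sum** of the curve `γ` over the times in `S`: the sum over the
collision times `t ∈ S` and the ordered contact pairs `(i, j)` at time `t` of `g t i j`
(a `finsum` in `t`; an honest finite sum when the collision times in `S` are finitely many,
`collisionPairSum_eq_finset_sum`, as on every bounded window of a hard-sphere trajectory).
This is the bookkeeping primitive `∑_{collisions} g` of the empirical (microscopic Enskog)
identities along one trajectory (Pulvirenti–Simonella 2015). [folklore] -/
def collisionPairSum {M : Type*} [AddCommMonoid M] (G : Geometry d X) (ε : ℝ)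
    (γ : ℝ → Config N d X) (S : Set ℝ) (g : ℝ → Fin N → Fin N → M) : M :=
  ∑ᶠ t ∈ collisionTimes G ε γ ∩ S, ∑ p ∈ contactPairs G ε (γ t), g t p.1 p.2

/-- The **collision sum** of a functional `F` of the collision record over the collisions of
`γ` with times in `S`: `Σ_{(t, i, j)} F (record of (t, i, j))`, records read off the
(post-collisional) value `γ t` (`HardSphereCollisionRecord.ofConfig`). [folklore] -/
def collisionSum {M : Type*} [AddCommMonoid M] (G : Geometry d X) (ε : ℝ)
    (γ : ℝ → Config N d X) (S : Set ℝ) (F : HardSphereCollisionRecord d X N → M) : M :=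
  collisionPairSum G ε γ S fun t i j => F (HardSphereCollisionRecord.ofConfig G ε (γ t) t i j)

variable {M : Type*} [AddCommMonoid M]

/-- Unfolding lemma for the collision sum. [folklore] -/
theorem collisionSum_eq_collisionPairSum (γ : ℝ → Config N d X) (S : Set ℝ)
    (F : HardSphereCollisionRecord d X N → M) :
    collisionSum G ε γ S F = collisionPairSum G ε γ S
      fun t i j => F (HardSphereCollisionRecord.ofConfig G ε (γ t) t i j) := rfl

/-- Finite-sum form of the collision pair sum. [folklore] -/
theorem collisionPairSum_eq_finset_sum {γ : ℝ → Config N d X} {S : Set ℝ}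
    (hfin : (collisionTimes G ε γ ∩ S).Finite) (g : ℝ → Fin N → Fin N → M) :
    collisionPairSum G ε γ S g =
      ∑ t ∈ hfin.toFinset, ∑ p ∈ contactPairs G ε (γ t), g t p.1 p.2 :=
  finsum_mem_eq_finite_toFinset_sum _ hfin

/-- Finite-sum form of the collision sum. [folklore] -/
theorem collisionSum_eq_finset_sum {γ : ℝ → Config N d X} {S : Set ℝ}
    (hfin : (collisionTimes G ε γ ∩ S).Finite) (F : HardSphereCollisionRecord d X N → M) :
    collisionSum G ε γ S F = ∑ t ∈ hfin.toFinset, ∑ p ∈ contactPairs G ε (γ t),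
      F (HardSphereCollisionRecord.ofConfig G ε (γ t) t p.1 p.2) :=
  collisionPairSum_eq_finset_sum hfin _

/-- **The inline form of the routes.** For a curve in the hard-sphere domain the collision pair
sum is `∑ᶠ t ∈ collisionTimes ∩ S, ∑ i, ∑ j, if i ≠ j ∧ ‖x_i(t) - x_j(t)‖ = ε then g t i j else 0`.
[folklore] -/
theorem collisionPairSum_eq_finsum_ite {γ : ℝ → Config N d X}
    (hγ : ∀ t, γ t ∈ hardSphereDomain G N ε) (S : Set ℝ) (g : ℝ → Fin N → Fin N → M) :
    collisionPairSum G ε γ S g = ∑ᶠ t ∈ collisionTimes G ε γ ∩ S, ∑ i, ∑ j,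
      if i ≠ j ∧ ‖G.sepVec (γ t i).1 (γ t j).1‖ = ε then g t i j else 0 :=
  finsum_mem_congr rfl fun t _ => sum_contactPairs_eq (hγ t) (g t)

/-- The collision pair sum as a sum over the collision triples. [folklore] -/
theorem collisionPairSum_eq_finsum_triples {γ : ℝ → Config N d X} {S : Set ℝ}
    (hfin : (collisionTimes G ε γ ∩ S).Finite) (g : ℝ → Fin N → Fin N → M) :
    collisionPairSum G ε γ S g = ∑ᶠ e ∈ collisionTriples G ε γ S, g e.1 e.2.1 e.2.2 := by
  rw [collisionPairSum_eq_finset_sum hfin,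
    finsum_mem_eq_finite_toFinset_sum _ (finite_collisionTriples hfin)]
  symm
  refine Finset.sum_finset_product (finite_collisionTriples hfin).toFinset hfin.toFinset
    (fun t => contactPairs G ε (γ t)) (fun e => ?_) (f := fun e => g e.1 e.2.1 e.2.2)
  rw [Set.Finite.mem_toFinset, Set.Finite.mem_toFinset, mem_collisionTriples]
  exact ⟨fun he => ⟨⟨mem_collisionTimes_of_mem_contactPairs he.2, he.1⟩, he.2⟩,
    fun he => ⟨he.1.2, he.2⟩⟩

/-- No times, no collisions. [folklore] -/
@[simp]
theorem collisionPairSum_empty (γ : ℝ → Config N d X) (g : ℝ → Fin N → Fin N → M) :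
    collisionPairSum G ε γ ∅ g = 0 := by
  simp [collisionPairSum]

/-- A window without collision times contributes nothing. [folklore] -/
theorem collisionPairSum_eq_zero_of_forall_not_mem {γ : ℝ → Config N d X} {S : Set ℝ}
    (hS : ∀ t ∈ S, t ∉ collisionTimes G ε γ) (g : ℝ → Fin N → Fin N → M) :
    collisionPairSum G ε γ S g = 0 := by
  have : collisionTimes G ε γ ∩ S = ∅ := Set.eq_empty_iff_forall_notMem.2 fun t ht => hS t ht.2 ht.1
  rw [collisionPairSum, this, finsum_mem_empty]

/-- **Additivity in the window** over disjoint sets of times (finitely many collision times in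
each). [folklore] -/
theorem collisionPairSum_union {γ : ℝ → Config N d X} {S T : Set ℝ}
    (hS : (collisionTimes G ε γ ∩ S).Finite) (hT : (collisionTimes G ε γ ∩ T).Finite)
    (hST : Disjoint S T) (g : ℝ → Fin N → Fin N → M) :
    collisionPairSum G ε γ (S ∪ T) g = collisionPairSum G ε γ S g + collisionPairSum G ε γ T g := by
  rw [collisionPairSum, collisionPairSum, collisionPairSum, inter_union_distrib_left,
    finsum_mem_union (hST.mono inter_subset_right inter_subset_right) hS hT]

/-- The collision pair sum is additive in the summand (finitely many collision times). [folklore] -/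
theorem collisionPairSum_add {γ : ℝ → Config N d X} {S : Set ℝ}
    (hfin : (collisionTimes G ε γ ∩ S).Finite) (g g' : ℝ → Fin N → Fin N → M) :
    collisionPairSum G ε γ S (fun t i j => g t i j + g' t i j) =
      collisionPairSum G ε γ S g + collisionPairSum G ε γ S g' := by
  simp only [collisionPairSum_eq_finset_sum hfin, Finset.sum_add_distrib]

/-- Constants come out of a real collision pair sum (finitely many collision times). [folklore] -/
theorem collisionPairSum_const_mul {γ : ℝ → Config N d X} {S : Set ℝ}
    (hfin : (collisionTimes G ε γ ∩ S).Finite) (a : ℝ) (g : ℝ → Fin N → Fin N → ℝ) :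
    collisionPairSum G ε γ S (fun t i j => a * g t i j) = a * collisionPairSum G ε γ S g := by
  simp only [collisionPairSum_eq_finset_sum hfin, Finset.mul_sum]

/-- Monotonicity of real collision pair sums in the summand (finitely many collision times).
[folklore] -/
theorem collisionPairSum_mono {γ : ℝ → Config N d X} {S : Set ℝ}
    (hfin : (collisionTimes G ε γ ∩ S).Finite) {g g' : ℝ → Fin N → Fin N → ℝ}
    (h : ∀ t ∈ collisionTimes G ε γ ∩ S, ∀ p ∈ contactPairs G ε (γ t), g t p.1 p.2 ≤ g' t p.1 p.2) :
    collisionPairSum G ε γ S g ≤ collisionPairSum G ε γ S g' := by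
  rw [collisionPairSum_eq_finset_sum hfin, collisionPairSum_eq_finset_sum hfin]
  exact Finset.sum_le_sum fun t ht => Finset.sum_le_sum fun p hp =>
    h t ((Set.Finite.mem_toFinset hfin).1 ht) p hp

/-- A nonnegative summand gives a nonnegative real collision pair sum. [folklore] -/
theorem collisionPairSum_nonneg {γ : ℝ → Config N d X} {S : Set ℝ} {g : ℝ → Fin N → Fin N → ℝ}
    (h : ∀ t i j, 0 ≤ g t i j) : 0 ≤ collisionPairSum G ε γ S g := by
  unfold collisionPairSum
  exact finsum_nonneg fun t => finsum_nonneg fun _ => Finset.sum_nonneg fun p _ => h t p.1 p.2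

variable [MeasurableSpace X]

/-- The **collision measure** of the curve `γ` over the times in `S`: the marked point measure
`Σ_{(t, i, j)} δ_{(t, x_i, ω, v_i⁻, v_j⁻)}` on `ℝ × X × ℝ^d × ℝ^d × ℝ^d`, one unit Dirac mass at
the mark of each collision triple (UNNORMALISED; the empirical collision measure of a route is a
multiple of it). [folklore] -/
def collisionMeasure (G : Geometry d X) (ε : ℝ) (γ : ℝ → Config N d X) (S : Set ℝ) :
    Measure (ℝ × X × EuclideanSpace ℝ d × EuclideanSpace ℝ d × EuclideanSpace ℝ d) :=
  collisionSum G ε γ S fun c => Measure.dirac c.mark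

/-- Finite-sum form of the collision measure. [folklore] -/
theorem collisionMeasure_eq_finset_sum {γ : ℝ → Config N d X} {S : Set ℝ}
    (hfin : (collisionTimes G ε γ ∩ S).Finite) :
    collisionMeasure G ε γ S = ∑ t ∈ hfin.toFinset, ∑ p ∈ contactPairs G ε (γ t),
      Measure.dirac (HardSphereCollisionRecord.ofConfig G ε (γ t) t p.1 p.2).mark :=
  collisionSum_eq_finset_sum hfin _

/-- **Integration against the collision measure is a collision sum** (lower Lebesgue integral;
finitely many collision times, measurable singletons in `X`). [folklore] -/
theorem lintegral_collisionMeasure [MeasurableSingletonClass X] {γ : ℝ → Config N d X}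
    {S : Set ℝ} (hfin : (collisionTimes G ε γ ∩ S).Finite)
    (f : ℝ × X × EuclideanSpace ℝ d × EuclideanSpace ℝ d × EuclideanSpace ℝ d → ℝ≥0∞) :
    ∫⁻ m, f m ∂collisionMeasure G ε γ S = collisionSum G ε γ S fun c => f c.mark := by
  rw [collisionMeasure_eq_finset_sum hfin, collisionSum_eq_finset_sum hfin,
    lintegral_finsetSum_measure]
  refine Finset.sum_congr rfl fun t _ => ?_
  rw [lintegral_finsetSum_measure]
  exact Finset.sum_congr rfl fun p _ => lintegral_dirac _ _

/-- **Integration against the collision measure is a collision sum** (Bochner integral;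
finitely many collision times, measurable singletons in `X`). [folklore] -/
theorem integral_collisionMeasure [MeasurableSingletonClass X] {E : Type*}
    [NormedAddCommGroup E] [NormedSpace ℝ E] [CompleteSpace E] {γ : ℝ → Config N d X} {S : Set ℝ}
    (hfin : (collisionTimes G ε γ ∩ S).Finite)
    (f : ℝ × X × EuclideanSpace ℝ d × EuclideanSpace ℝ d × EuclideanSpace ℝ d → E) :
    ∫ m, f m ∂collisionMeasure G ε γ S = collisionSum G ε γ S fun c => f c.mark := by
  have hint : ∀ a : ℝ × X × EuclideanSpace ℝ d × EuclideanSpace ℝ d × EuclideanSpace ℝ d,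
      Integrable f (Measure.dirac a) := fun a => integrable_dirac (by simp)
  rw [collisionMeasure_eq_finset_sum hfin, collisionSum_eq_finset_sum hfin,
    integral_finsetSum_measure fun t _ => integrable_finsetSum_measure.2 fun p _ => hint _]
  refine Finset.sum_congr rfl fun t _ => ?_
  rw [integral_finsetSum_measure fun p _ => hint _]
  exact Finset.sum_congr rfl fun p _ => integral_dirac _ _

/-- The total mass of the collision measure is the number of collision triples (as a collision
sum of ones). [folklore] -/
theorem collisionMeasure_univ {γ : ℝ → Config N d X} {S : Set ℝ}
    (hfin : (collisionTimes G ε γ ∩ S).Finite) :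
    collisionMeasure G ε γ S univ = collisionSum G ε γ S fun _ => (1 : ℝ≥0∞) := by
  rw [← MeasureTheory.lintegral_one, collisionMeasure_eq_finset_sum hfin,
    collisionSum_eq_finset_sum hfin, lintegral_finsetSum_measure]
  refine Finset.sum_congr rfl fun t _ => ?_
  rw [lintegral_finsetSum_measure]
  exact Finset.sum_congr rfl fun p _ => by simp

/-- The collision measure of a window with finitely many collision times is finite. [folklore] -/
theorem isFiniteMeasure_collisionMeasure {γ : ℝ → Config N d X} {S : Set ℝ}
    (hfin : (collisionTimes G ε γ ∩ S).Finite) : IsFiniteMeasure (collisionMeasure G ε γ S) := by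
  refine ⟨?_⟩
  rw [collisionMeasure_univ hfin, collisionSum_eq_finset_sum hfin]
  exact ENNReal.sum_lt_top.2 fun t _ => ENNReal.sum_lt_top.2 fun p _ => ENNReal.one_lt_top

end Sums

/-! ## Along a hard-sphere trajectory: binary collisions and left limits -/

namespace IsHardSphereTrajectory

variable [TopologicalSpace X] {G : Geometry d X} {ε : ℝ} {γ : ℝ → Config N d X}

/-- Two two-element finsets coincide iff their elements coincide up to order. [folklore] -/
private theorem pair_eq_pair_iff {i j a b : Fin N} :
    ({i, j} : Finset (Fin N)) = {a, b} ↔ i = a ∧ j = b ∨ i = b ∧ j = a := by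
  rw [← Finset.coe_inj, Finset.coe_pair, Finset.coe_pair, Set.pair_eq_pair_iff]

/-- On a hard-sphere trajectory every bounded set of times carries finitely many collision
times. [folklore] -/
theorem finite_collisionTimes_inter_of_subset_Icc (h : IsHardSphereTrajectory G ε N γ)
    {S : Set ℝ} {a b : ℝ} (hS : S ⊆ Icc a b) : (collisionTimes G ε γ ∩ S).Finite :=
  (h.locFinite a b).subset (inter_subset_inter_right _ hS)

/-- **Binary collisions, ordered form**: if `(p, q)` is in contact at time `t`, every ordered
contact pair at time `t` is `(p, q)` or `(q, p)` (`IsHardSphereTrajectory.binary`). [folklore] -/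
theorem eq_or_eq_of_mem_contactPairs (h : IsHardSphereTrajectory G ε N γ) {t : ℝ} {p q : Fin N}
    (hpq : (p, q) ∈ contactPairs G ε (γ t)) {e : Fin N × Fin N}
    (he : e ∈ contactPairs G ε (γ t)) : e = (p, q) ∨ e = (q, p) := by
  obtain ⟨hne, hc⟩ := mem_contactPairs.1 hpq
  obtain ⟨hne', hc'⟩ := mem_contactPairs.1 he
  obtain ⟨huniq, -⟩ := h.binary t p q hne hc
  rcases pair_eq_pair_iff.1 (huniq e.1 e.2 hne' hc') with ⟨h1, h2⟩ | ⟨h1, h2⟩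
  · exact Or.inl (Prod.ext h1 h2)
  · exact Or.inr (Prod.ext h1 h2)

/-- In a regular geometry the ordered contact pairs at a collision of `(p, q)` are exactly
`(p, q)` and `(q, p)`: existence and uniqueness of the colliding pair. [folklore] -/
theorem contactPairs_eq_pair (h : IsHardSphereTrajectory G ε N γ) (hG : G.IsHardSphereRegular ε)
    {t : ℝ} {p q : Fin N} (hpq : (p, q) ∈ contactPairs G ε (γ t)) :
    contactPairs G ε (γ t) = {(p, q), (q, p)} := by
  ext e
  rw [Finset.mem_insert, Finset.mem_singleton]
  refine ⟨h.eq_or_eq_of_mem_contactPairs hpq, ?_⟩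
  rintro (rfl | rfl)
  · exact hpq
  · exact (swap_mem_contactPairs_iff hG).2 hpq

/-- In a regular geometry a hard-sphere trajectory has exactly two ORDERED contact pairs at
each collision time. [folklore] -/
theorem card_contactPairs_eq_two (h : IsHardSphereTrajectory G ε N γ)
    (hG : G.IsHardSphereRegular ε) {t : ℝ} (ht : t ∈ collisionTimes G ε γ) :
    (contactPairs G ε (γ t)).card = 2 := by
  obtain ⟨p, hp⟩ := mem_collisionTimes_iff_contactPairs_nonempty.1 ht
  obtain ⟨p, q⟩ := p
  rw [h.contactPairs_eq_pair hG hp, Finset.card_pair]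
  intro hpe
  exact (mem_contactPairs.1 hp).1 (Prod.mk.inj hpe).1

/-- **Once-per-collision counting**: in a regular geometry the collision sum of the indicator
`fst < snd` over the window `[a, b]` is the number of collisions `numCollisions G ε γ a b`.
[folklore] -/
theorem collisionSum_ite_lt_eq_numCollisions (h : IsHardSphereTrajectory G ε N γ)
    (hG : G.IsHardSphereRegular ε) (a b : ℝ) :
    collisionSum G ε γ (Icc a b) (fun c => if c.fst < c.snd then (1 : ℕ) else 0) =
      numCollisions G ε γ a b := by
  classical
  have hfin := h.locFinite a b
  rw [collisionSum_eq_finset_sum hfin, h.numCollisions_eq a b, Finset.card_eq_sum_ones]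
  refine Finset.sum_congr rfl fun t ht => ?_
  have ht' : t ∈ collisionTimes G ε γ := ((Set.Finite.mem_toFinset hfin).1 ht).1
  obtain ⟨⟨p, q⟩, hp⟩ := mem_collisionTimes_iff_contactPairs_nonempty.1 ht'
  have hpq : p ≠ q := (mem_contactPairs.1 hp).1
  have hne : (p, q) ≠ (q, p) := fun hpe => hpq (Prod.mk.inj hpe).1
  rw [h.contactPairs_eq_pair hG hp, Finset.sum_pair hne]
  simp only [HardSphereCollisionRecord.ofConfig_fst, HardSphereCollisionRecord.ofConfig_snd]
  rcases lt_or_gt_of_ne hpq with hlt | hgt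
  · rw [if_pos hlt, if_neg (not_lt.2 hlt.le)]
  · rw [if_neg (not_lt.2 hgt.le), if_pos hgt]

/-- In a regular geometry the collision sum of `1` over `[a, b]` is twice the number of
collisions (each collision is recorded in its two orders). [folklore] -/
theorem collisionSum_one_eq_two_mul_numCollisions (h : IsHardSphereTrajectory G ε N γ)
    (hG : G.IsHardSphereRegular ε) (a b : ℝ) :
    collisionSum G ε γ (Icc a b) (fun _ => (1 : ℕ)) = 2 * numCollisions G ε γ a b := by
  have hfin := h.locFinite a b
  rw [collisionSum_eq_finset_sum hfin, h.numCollisions_eq a b, Finset.card_eq_sum_ones,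
    Finset.mul_sum]
  refine Finset.sum_congr rfl fun t ht => ?_
  rw [Finset.sum_const, smul_eq_mul, mul_one, mul_one,
    h.card_contactPairs_eq_two hG ((Set.Finite.mem_toFinset hfin).1 ht).1]

/-- **The pre-collisional configuration by the involution**: at a collision of `(i, j)` the
trajectory tends, from the left, to `collidePair G i j (γ t)` (from `binary` and
`collidePair_collidePair`; no separation axiom needed). [folklore] -/
theorem tendsto_collidePair (h : IsHardSphereTrajectory G ε N γ) {t : ℝ} {i j : Fin N}
    (hij : i ≠ j) (hc : γ t ∈ contactSet G N ε i j) :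
    Tendsto γ (𝓝[<] t) (𝓝 (collidePair G i j (γ t))) := by
  obtain ⟨-, zl, hzl, -, heq⟩ := h.binary t i j hij hc
  rwa [heq, collidePair_collidePair hij]

/-- The pre-collisional configuration `collidePair G i j (γ t)` is incoming for the colliding
pair (no grazing). [folklore] -/
theorem isIncoming_collidePair (h : IsHardSphereTrajectory G ε N γ) {t : ℝ} {i j : Fin N}
    (hij : i ≠ j) (hc : γ t ∈ contactSet G N ε i j) :
    IsIncoming G (collidePair G i j (γ t)) i j := by
  obtain ⟨-, zl, -, hin, heq⟩ := h.binary t i j hij hc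
  rwa [heq, collidePair_collidePair hij]

/-- The post-collisional configuration `γ t` is outgoing for the colliding pair. [folklore] -/
theorem isOutgoing_of_mem_contactSet (h : IsHardSphereTrajectory G ε N γ) {t : ℝ} {i j : Fin N}
    (hij : i ≠ j) (hc : γ t ∈ contactSet G N ε i j) : IsOutgoing G (γ t) i j := by
  have hin := h.isIncoming_collidePair hij hc
  rwa [← collidePair_collidePair (G := G) hij (γ t), isOutgoing_collidePair_iff hij]

/-- In a Hausdorff position space the left limit at a collision of `(i, j)` IS
`collidePair G i j (γ t)`. [folklore] -/
theorem leftLim_eq_collidePair [T2Space X] (h : IsHardSphereTrajectory G ε N γ) {t : ℝ}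
    {i j : Fin N} (hij : i ≠ j) (hc : γ t ∈ contactSet G N ε i j) :
    leftLim γ t = collidePair G i j (γ t) :=
  leftLim_eq_of_tendsto (h.tendsto_collidePair hij hc)

/-- **The recorded pre-collisional velocities are the left limits**: at a collision of the
ordered pair `(i, j)` of a hard-sphere trajectory in a Hausdorff position space,
`(ofConfig G ε (γ t) t i j).preVel = (v_i(t⁻), v_j(t⁻))`. [folklore] -/
theorem ofConfig_preVel_eq_leftLim [T2Space X] (h : IsHardSphereTrajectory G ε N γ) {t : ℝ}
    {i j : Fin N} (hp : (i, j) ∈ contactPairs G ε (γ t)) :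
    (HardSphereCollisionRecord.ofConfig G ε (γ t) t i j).preVel =
      ((leftLim γ t i).2, (leftLim γ t j).2) := by
  obtain ⟨hij, hc⟩ := mem_contactPairs.1 hp
  rw [h.leftLim_eq_collidePair hij hc]
  exact HardSphereCollisionRecord.ofConfig_preVel_eq_collidePair G ε (γ t) t hij

/-- The recorded pre-collisional velocities are incoming: `⟪x_i - x_j, v_i⁻ - v_j⁻⟫ < 0`.
[folklore] -/
theorem inner_sepVec_preVel_neg (h : IsHardSphereTrajectory G ε N γ) {t : ℝ} {i j : Fin N}
    (hp : (i, j) ∈ contactPairs G ε (γ t)) :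
    inner ℝ (G.sepVec (γ t i).1 (γ t j).1)
      ((HardSphereCollisionRecord.ofConfig G ε (γ t) t i j).preVel.1 -
        (HardSphereCollisionRecord.ofConfig G ε (γ t) t i j).preVel.2) < 0 := by
  obtain ⟨hij, hc⟩ := mem_contactPairs.1 hp
  have hin := h.isIncoming_collidePair hij hc
  rw [HardSphereCollisionRecord.ofConfig_preVel_eq_collidePair G ε (γ t) t hij]
  simpa [IsIncoming, collidePair_apply_fst] using hin

/-- The recorded post-collisional velocities are outgoing: `0 < ⟪x_i - x_j, v_i⁺ - v_j⁺⟫`.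
[folklore] -/
theorem inner_sepVec_postVel_pos (h : IsHardSphereTrajectory G ε N γ) {t : ℝ} {i j : Fin N}
    (hp : (i, j) ∈ contactPairs G ε (γ t)) :
    0 < inner ℝ (G.sepVec (γ t i).1 (γ t j).1)
      ((HardSphereCollisionRecord.ofConfig G ε (γ t) t i j).postVel.1 -
        (HardSphereCollisionRecord.ofConfig G ε (γ t) t i j).postVel.2) := by
  obtain ⟨hij, hc⟩ := mem_contactPairs.1 hp
  exact h.isOutgoing_of_mem_contactSet hij hc

end IsHardSphereTrajectory

/-! ## Participation, partners, flights and enumeration of collision times -/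

section Participation

variable {G : Geometry d X} {ε : ℝ}

/-- Particles `i` and `j` **collide** in the configuration `z`: `(i, j)` or `(j, i)` is an
ordered contact pair (the two orders agree in a regular geometry, `swap_mem_contactPairs_iff`).
[folklore] -/
def Collide (G : Geometry d X) (ε : ℝ) (z : Config N d X) (i j : Fin N) : Prop :=
  (i, j) ∈ contactPairs G ε z ∨ (j, i) ∈ contactPairs G ε z

/-- Particle `k` **participates** in a collision in the configuration `z`: it collides with
some particle. [folklore] -/
def Participates (G : Geometry d X) (ε : ℝ) (z : Config N d X) (k : Fin N) : Prop :=
  ∃ j, Collide G ε z k j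

/-- `Collide` is symmetric. [folklore] -/
theorem Collide.symm {z : Config N d X} {i j : Fin N} (h : Collide G ε z i j) :
    Collide G ε z j i :=
  Or.symm h

/-- Colliding particles are distinct. [folklore] -/
theorem Collide.ne {z : Config N d X} {i j : Fin N} (h : Collide G ε z i j) : i ≠ j := by
  rcases h with h | h
  · exact (mem_contactPairs.1 h).1
  · exact fun hij => (mem_contactPairs.1 h).1 hij.symm

/-- The **collision times of particle `k`** along the curve `γ`: the times at which `k`
participates in a collision. [folklore] -/
def collisionTimesOf (G : Geometry d X) (ε : ℝ) (γ : ℝ → Config N d X) (k : Fin N) : Set ℝ :=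
  {t | Participates G ε (γ t) k}

/-- Membership in the collision times of a particle. [folklore] -/
theorem mem_collisionTimesOf {γ : ℝ → Config N d X} {k : Fin N} {t : ℝ} :
    t ∈ collisionTimesOf G ε γ k ↔ Participates G ε (γ t) k := Iff.rfl

/-- A collision time of a particle is a collision time. [folklore] -/
theorem collisionTimesOf_subset (γ : ℝ → Config N d X) (k : Fin N) :
    collisionTimesOf G ε γ k ⊆ collisionTimes G ε γ := by
  rintro t ⟨j, h | h⟩
  · exact mem_collisionTimes_of_mem_contactPairs h
  · exact mem_collisionTimes_of_mem_contactPairs h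

/-- A time is a collision time iff some particle participates in a collision then. [folklore] -/
theorem mem_collisionTimes_iff_exists_participates {γ : ℝ → Config N d X} {t : ℝ} :
    t ∈ collisionTimes G ε γ ↔ ∃ k, Participates G ε (γ t) k := by
  rw [mem_collisionTimes_iff_contactPairs_nonempty]
  constructor
  · rintro ⟨p, hp⟩
    exact ⟨p.1, p.2, Or.inl hp⟩
  · rintro ⟨k, j, h | h⟩
    · exact ⟨_, h⟩
    · exact ⟨_, h⟩

open scoped Classical in
/-- The **partner** of particle `i` in the configuration `z`: the least particle colliding with
`i` (for a binary collision, THE particle colliding with `i`,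
`IsHardSphereTrajectory.partner_eq`); junk value `i` itself if `i` collides with nobody.
[folklore] -/
def partner (G : Geometry d X) (ε : ℝ) (z : Config N d X) (i : Fin N) : Fin N :=
  if h : (Finset.univ.filter fun j => Collide G ε z i j).Nonempty then
    (Finset.univ.filter fun j => Collide G ε z i j).min' h
  else i

/-- If `i` participates in a collision, it collides with its partner. [folklore] -/
theorem collide_partner {z : Config N d X} {i : Fin N} (hi : Participates G ε z i) :
    Collide G ε z i (partner G ε z i) := by
  classical
  obtain ⟨j, hj⟩ := hi
  have hne : (Finset.univ.filter fun j => Collide G ε z i j).Nonempty :=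
    ⟨j, Finset.mem_filter.2 ⟨Finset.mem_univ j, hj⟩⟩
  rw [partner, dif_pos hne]
  exact (Finset.mem_filter.1 (Finset.min'_mem _ hne)).2

/-- A particle that collides with nobody is its own (junk) partner. [folklore] -/
theorem partner_of_not_participates {z : Config N d X} {i : Fin N} (hi : ¬ Participates G ε z i) :
    partner G ε z i = i := by
  classical
  have hne : ¬ (Finset.univ.filter fun j => Collide G ε z i j).Nonempty := by
    rintro ⟨j, hj⟩
    exact hi ⟨j, (Finset.mem_filter.1 hj).2⟩
  rw [partner, dif_neg hne]

/-- The **start of the current free flight** of particle `k` at time `t`, for a history starting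
at time `a`: the last collision time of `k` in the open interval `(a, t)`, or `a` if there is
none (`sSup` of a finite set on a hard-sphere trajectory, `IsHardSphereTrajectory.flightStart_mem`;
for `t ≤ a` the value is `a`). The configuration `γ (flightStart …)` is the state of the system
when `k` started the flight it is on just before time `t`. [folklore] -/
def flightStart (G : Geometry d X) (ε : ℝ) (γ : ℝ → Config N d X) (a : ℝ) (k : Fin N) (t : ℝ) : ℝ :=
  sSup (insert a (collisionTimesOf G ε γ k ∩ Ioo a t))

/-- With finitely many collision times of `k` in `(a, t)`, the flight start is `a` or one of
them. [folklore] -/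
theorem flightStart_mem {γ : ℝ → Config N d X} {a : ℝ} {k : Fin N} {t : ℝ}
    (hfin : (collisionTimesOf G ε γ k ∩ Ioo a t).Finite) :
    flightStart G ε γ a k t ∈ insert a (collisionTimesOf G ε γ k ∩ Ioo a t) :=
  (Set.insert_nonempty a _).csSup_mem (hfin.insert a)

/-- The flight start is at least the initial time. [folklore] -/
theorem le_flightStart {γ : ℝ → Config N d X} {a : ℝ} {k : Fin N} {t : ℝ}
    (hfin : (collisionTimesOf G ε γ k ∩ Ioo a t).Finite) : a ≤ flightStart G ε γ a k t :=
  le_csSup (hfin.insert a).bddAbove (mem_insert a _)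

/-- The flight start is before `t` (for `a < t`). [folklore] -/
theorem flightStart_lt {γ : ℝ → Config N d X} {a : ℝ} {k : Fin N} {t : ℝ}
    (hfin : (collisionTimesOf G ε γ k ∩ Ioo a t).Finite) (hat : a < t) :
    flightStart G ε γ a k t < t := by
  rcases (mem_insert_iff.1 (flightStart_mem hfin)) with h | h
  · rwa [h]
  · exact h.2.2

/-- Every collision time of `k` in `(a, t)` is at most the flight start. [folklore] -/
theorem le_flightStart_of_mem {γ : ℝ → Config N d X} {a : ℝ} {k : Fin N} {t : ℝ}
    (hfin : (collisionTimesOf G ε γ k ∩ Ioo a t).Finite) {s : ℝ}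
    (hs : s ∈ collisionTimesOf G ε γ k) (has : a < s) (hst : s < t) :
    s ≤ flightStart G ε γ a k t :=
  le_csSup (hfin.insert a).bddAbove (mem_insert_of_mem a ⟨hs, has, hst⟩)

/-- **The current flight is free**: particle `k` has no collision strictly between its flight
start and `t`. [folklore] -/
theorem not_participates_of_mem_Ioo_flightStart {γ : ℝ → Config N d X} {a : ℝ} {k : Fin N}
    {t : ℝ} (hfin : (collisionTimesOf G ε γ k ∩ Ioo a t).Finite) {u : ℝ}
    (hu : u ∈ Ioo (flightStart G ε γ a k t) t) : ¬ Participates G ε (γ u) k := fun hk =>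
  (not_le.2 hu.1) (le_flightStart_of_mem hfin hk ((le_flightStart hfin).trans_lt hu.1) hu.2)

/-- The **next element of `S` after `x`**: `sInf (S ∩ (x, ∞))` (the least element when `S` is
locally finite and meets `(x, ∞)`, `isLeast_nextTimeAfter`; junk value `0` = `sInf ∅` when `S`
has no element after `x`). [folklore] -/
def nextTimeAfter (S : Set ℝ) (x : ℝ) : ℝ := sInf (S ∩ Ioi x)

/-- The **`n`-th element of `S` after `a`** (`n = 0` is the first): `nextTimeAfter` iterated
`n + 1` times from `a`. [folklore] -/
def nthTimeAfter (S : Set ℝ) (a : ℝ) (n : ℕ) : ℝ := (nextTimeAfter S)^[n + 1] a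

omit [Fintype d] in
/-- The first element after `a`. [folklore] -/
@[simp]
theorem nthTimeAfter_zero (S : Set ℝ) (a : ℝ) : nthTimeAfter S a 0 = nextTimeAfter S a := rfl

omit [Fintype d] in
/-- The recursion of the enumeration: the `(n+1)`-st element after `a` is the next one after the
`n`-th. [folklore] -/
theorem nthTimeAfter_succ (S : Set ℝ) (a : ℝ) (n : ℕ) :
    nthTimeAfter S a (n + 1) = nextTimeAfter S (nthTimeAfter S a n) := by
  rw [nthTimeAfter, nthTimeAfter, Function.iterate_succ_apply']

omit [Fintype d] in
/-- For a set that is finite on bounded intervals and meets `(x, ∞)`, `nextTimeAfter S x` is the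
least element of `S` after `x`. [folklore] -/
theorem isLeast_nextTimeAfter {S : Set ℝ} {x : ℝ} (hfin : ∀ b, (S ∩ Ioc x b).Finite)
    (hne : (S ∩ Ioi x).Nonempty) : IsLeast (S ∩ Ioi x) (nextTimeAfter S x) := by
  obtain ⟨b, hbS, hxb⟩ := hne
  have hbF : b ∈ S ∩ Ioc x b := ⟨hbS, hxb, le_rfl⟩
  set F := (hfin b).toFinset with hF
  have hFne : F.Nonempty := ⟨b, (Set.Finite.mem_toFinset _).2 hbF⟩
  have hmin : IsLeast (S ∩ Ioi x) (F.min' hFne) := by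
    refine ⟨?_, fun s hs => ?_⟩
    · have hm := (Set.Finite.mem_toFinset (hfin b)).1 (F.min'_mem hFne)
      exact ⟨hm.1, hm.2.1⟩
    · rcases le_or_gt s b with hsb | hbs
      · exact F.min'_le s ((Set.Finite.mem_toFinset _).2 ⟨hs.1, hs.2, hsb⟩)
      · exact (F.min'_le b ((Set.Finite.mem_toFinset _).2 hbF)).trans hbs.le
  rw [nextTimeAfter, hmin.csInf_eq]
  exact hmin

omit [Fintype d] in
/-- With no element of `S` after `x` the next time is the junk value `0`. [folklore] -/
theorem nextTimeAfter_of_eq_empty {S : Set ℝ} {x : ℝ} (h : S ∩ Ioi x = ∅) :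
    nextTimeAfter S x = 0 := by
  rw [nextTimeAfter, h, Real.sInf_empty]

/-- The **`n`-th collision time after `a`** of the curve `γ` (`n = 0`: the first collision
strictly after `a`). [folklore] -/
def nthCollisionTime (G : Geometry d X) (ε : ℝ) (γ : ℝ → Config N d X) (a : ℝ) (n : ℕ) : ℝ :=
  nthTimeAfter (collisionTimes G ε γ) a n

/-- The **`n`-th collision time of particle `k` after `a`** along the curve `γ`. [folklore] -/
def nthCollisionTimeOf (G : Geometry d X) (ε : ℝ) (γ : ℝ → Config N d X) (a : ℝ) (k : Fin N)
    (n : ℕ) : ℝ :=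
  nthTimeAfter (collisionTimesOf G ε γ k) a n

end Participation

namespace IsHardSphereTrajectory

variable [TopologicalSpace X] {G : Geometry d X} {ε : ℝ} {γ : ℝ → Config N d X}

/-- **Binary collisions and participation**: at a collision of the ordered pair `(i, j)` the
participating particles are exactly `i` and `j`. [folklore] -/
theorem participates_iff (h : IsHardSphereTrajectory G ε N γ) {t : ℝ} {i j : Fin N}
    (hp : (i, j) ∈ contactPairs G ε (γ t)) {k : Fin N} :
    Participates G ε (γ t) k ↔ k = i ∨ k = j := by
  constructor
  · rintro ⟨l, hkl | hlk⟩
    · rcases h.eq_or_eq_of_mem_contactPairs hp hkl with he | he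
      · exact Or.inl (Prod.mk.inj he).1
      · exact Or.inr (Prod.mk.inj he).1
    · rcases h.eq_or_eq_of_mem_contactPairs hp hlk with he | he
      · exact Or.inr (Prod.mk.inj he).2
      · exact Or.inl (Prod.mk.inj he).2
  · rintro (rfl | rfl)
    · exact ⟨j, Or.inl hp⟩
    · exact ⟨i, Or.inr hp⟩

/-- At a collision of the ordered pair `(i, j)`, the only particle colliding with `i` is `j`.
[folklore] -/
theorem eq_of_collide (h : IsHardSphereTrajectory G ε N γ) {t : ℝ} {i j : Fin N}
    (hp : (i, j) ∈ contactPairs G ε (γ t)) {l : Fin N} (hl : Collide G ε (γ t) i l) : l = j := by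
  have hij : i ≠ j := (mem_contactPairs.1 hp).1
  rcases hl with hil | hli
  · rcases h.eq_or_eq_of_mem_contactPairs hp hil with he | he
    · exact (Prod.mk.inj he).2
    · exact absurd (Prod.mk.inj he).1 hij
  · rcases h.eq_or_eq_of_mem_contactPairs hp hli with he | he
    · exact absurd (Prod.mk.inj he).2 hij
    · exact (Prod.mk.inj he).1

/-- **The partner is the partner**: at a collision of the ordered pair `(i, j)`,
`partner G ε (γ t) i = j` and `partner G ε (γ t) j = i`. [folklore] -/
theorem partner_eq (h : IsHardSphereTrajectory G ε N γ) {t : ℝ} {i j : Fin N}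
    (hp : (i, j) ∈ contactPairs G ε (γ t)) :
    partner G ε (γ t) i = j ∧ partner G ε (γ t) j = i := by
  refine ⟨h.eq_of_collide hp (collide_partner ⟨j, Or.inl hp⟩), ?_⟩
  have hl : Collide G ε (γ t) j (partner G ε (γ t) j) := collide_partner ⟨i, Or.inr hp⟩
  have hij : i ≠ j := (mem_contactPairs.1 hp).1
  rcases hl with hjl | hlj
  · rcases h.eq_or_eq_of_mem_contactPairs hp hjl with he | he
    · exact absurd (Prod.mk.inj he).1.symm hij
    · exact (Prod.mk.inj he).2
  · rcases h.eq_or_eq_of_mem_contactPairs hp hlj with he | he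
    · exact (Prod.mk.inj he).1
    · exact absurd (Prod.mk.inj he).2 hij.symm

/-- On a hard-sphere trajectory the collision times of a particle in a bounded window are
finitely many. [folklore] -/
theorem finite_collisionTimesOf_inter_Ioo (h : IsHardSphereTrajectory G ε N γ) (k : Fin N)
    (a t : ℝ) : (collisionTimesOf G ε γ k ∩ Ioo a t).Finite :=
  (h.locFinite a t).subset
    (inter_subset_inter (collisionTimesOf_subset γ k) Ioo_subset_Icc_self)

/-- On a hard-sphere trajectory the flight start of `k` at time `t` is `a` or a collision time
of `k` in `(a, t)`. [folklore] -/
theorem flightStart_mem (h : IsHardSphereTrajectory G ε N γ) (a : ℝ) (k : Fin N) (t : ℝ) :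
    flightStart G ε γ a k t ∈ insert a (collisionTimesOf G ε γ k ∩ Ioo a t) :=
  FluidPDE.flightStart_mem (h.finite_collisionTimesOf_inter_Ioo k a t)

/-- On a hard-sphere trajectory particle `k` does not collide strictly between its flight start
and `t`. [folklore] -/
theorem not_participates_of_mem_Ioo_flightStart (h : IsHardSphereTrajectory G ε N γ) {a : ℝ}
    {k : Fin N} {t u : ℝ} (hu : u ∈ Ioo (flightStart G ε γ a k t) t) :
    ¬ Participates G ε (γ u) k :=
  FluidPDE.not_participates_of_mem_Ioo_flightStart (h.finite_collisionTimesOf_inter_Ioo k a t) hu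

/-- On a hard-sphere trajectory with a collision after `a`, the first collision time after `a`
is the least collision time in `(a, ∞)`. [folklore] -/
theorem isLeast_nthCollisionTime_zero (h : IsHardSphereTrajectory G ε N γ) {a : ℝ}
    (hne : (collisionTimes G ε γ ∩ Ioi a).Nonempty) :
    IsLeast (collisionTimes G ε γ ∩ Ioi a) (nthCollisionTime G ε γ a 0) :=
  isLeast_nextTimeAfter (fun _ => h.finite_collisionTimes_inter_of_subset_Icc Ioc_subset_Icc_self)
    hne

/-- On a hard-sphere trajectory, if particle `k` collides after `a`, its first collision time
after `a` is the least element of its collision times in `(a, ∞)`. [folklore] -/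
theorem isLeast_nthCollisionTimeOf_zero (h : IsHardSphereTrajectory G ε N γ) {a : ℝ} {k : Fin N}
    (hne : (collisionTimesOf G ε γ k ∩ Ioi a).Nonempty) :
    IsLeast (collisionTimesOf G ε γ k ∩ Ioi a) (nthCollisionTimeOf G ε γ a k 0) :=
  isLeast_nextTimeAfter (fun b => (h.locFinite a b).subset
    (inter_subset_inter (collisionTimesOf_subset γ k) Ioc_subset_Icc_self)) hne

end IsHardSphereTrajectory

/-! ## The collision DAG: edges, paths, ancestry, path-pair census, fresh and ring collisions -/

section Dag

variable {G : Geometry d X} {ε : ℝ}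

/-- The **edge `s → t` of the collision DAG carried by particle `k`**: `s < t` are consecutive
collision times of `k` along `γ` (it participates at `s` and at `t` and in no collision strictly
in between), i.e. the free flight of `k` arriving at the collision `t` started at the collision
`s`. [folklore] -/
def IsDagEdgeVia (G : Geometry d X) (ε : ℝ) (γ : ℝ → Config N d X) (k : Fin N) (s t : ℝ) : Prop :=
  s < t ∧ Participates G ε (γ s) k ∧ Participates G ε (γ t) k ∧
    ∀ u ∈ Ioo s t, ¬ Participates G ε (γ u) k

/-- The **edges of the collision DAG** of `γ` on the window `(a, ∞)`: `s → t` iff `a < s` and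
the edge is carried by some particle (vertices are the collision times after `a`; by
`IsHardSphereTrajectory.binary` a hard-sphere trajectory has one collision per collision time).
Each vertex has at most two incoming edges, from the flight starts of its two partners
(`IsHardSphereTrajectory.isDagEdge_iff`, `setOf_isDagEdge_subset`), and symmetrically at most
two outgoing ones. [folklore] -/
def IsDagEdge (G : Geometry d X) (ε : ℝ) (γ : ℝ → Config N d X) (a : ℝ) (s t : ℝ) : Prop :=
  a < s ∧ ∃ k, IsDagEdgeVia G ε γ k s t

/-- An edge goes forward in time. [folklore] -/
theorem IsDagEdgeVia.lt {γ : ℝ → Config N d X} {k : Fin N} {s t : ℝ}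
    (h : IsDagEdgeVia G ε γ k s t) : s < t := h.1

/-- An edge of the DAG goes forward in time and starts after the window start. [folklore] -/
theorem IsDagEdge.lt {γ : ℝ → Config N d X} {a s t : ℝ} (h : IsDagEdge G ε γ a s t) :
    a < s ∧ s < t := by
  obtain ⟨has, k, hk⟩ := h
  exact ⟨has, hk.lt⟩

/-- The endpoints of an edge are collision times. [folklore] -/
theorem IsDagEdge.mem_collisionTimes {γ : ℝ → Config N d X} {a s t : ℝ}
    (h : IsDagEdge G ε γ a s t) : s ∈ collisionTimes G ε γ ∧ t ∈ collisionTimes G ε γ := by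
  obtain ⟨-, k, -, hs, ht, -⟩ := h
  exact ⟨mem_collisionTimes_iff_exists_participates.2 ⟨k, hs⟩,
    mem_collisionTimes_iff_exists_participates.2 ⟨k, ht⟩⟩

/-- **Uniqueness of the parent via a given particle**: two edges into `t` carried by the same
particle start at the same time (the previous collision of that particle). [folklore] -/
theorem IsDagEdgeVia.unique {γ : ℝ → Config N d X} {k : Fin N} {s s' t : ℝ}
    (h : IsDagEdgeVia G ε γ k s t) (h' : IsDagEdgeVia G ε γ k s' t) : s = s' := by
  by_contra hne
  rcases lt_or_gt_of_ne hne with hlt | hgt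
  · exact h.2.2.2 s' ⟨hlt, h'.1⟩ h'.2.1
  · exact h'.2.2.2 s ⟨hgt, h.1⟩ h.2.1

/-- The edge into `t` carried by `k` starts at the flight start of `k` (window `(a, ∞)`, edge
starting after `a`, finitely many collision times of `k` in `(a, t)`). [folklore] -/
theorem IsDagEdgeVia.eq_flightStart {γ : ℝ → Config N d X} {k : Fin N} {a s t : ℝ}
    (h : IsDagEdgeVia G ε γ k s t) (has : a < s)
    (hfin : (collisionTimesOf G ε γ k ∩ Ioo a t).Finite) : s = flightStart G ε γ a k t := by
  have hle : s ≤ flightStart G ε γ a k t := le_flightStart_of_mem hfin h.2.1 has h.1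
  rcases hle.eq_or_lt with heq | hlt
  · exact heq
  · exfalso
    have hmem := flightStart_mem hfin
    rcases mem_insert_iff.1 hmem with hfa | hfs
    · rw [hfa] at hlt
      exact lt_irrefl _ (has.trans hlt)
    · exact h.2.2.2 _ ⟨hlt, hfs.2.2⟩ hfs.1

/-- The **directed paths of length `m` ending at `t`** in the collision DAG on `(a, ∞)`:
sequences `p 0 → p 1 → ⋯ → p m = t` of consecutive edges. [folklore] -/
def dagPathsTo (G : Geometry d X) (ε : ℝ) (γ : ℝ → Config N d X) (a : ℝ) (m : ℕ) (t : ℝ) :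
    Set (Fin (m + 1) → ℝ) :=
  {p | p (Fin.last m) = t ∧ ∀ r : Fin m, IsDagEdge G ε γ a (p r.castSucc) (p r.succ)}

/-- The directed paths of length `m` from `s` to `t`. [folklore] -/
def dagPaths (G : Geometry d X) (ε : ℝ) (γ : ℝ → Config N d X) (a : ℝ) (m : ℕ) (s t : ℝ) :
    Set (Fin (m + 1) → ℝ) :=
  {p ∈ dagPathsTo G ε γ a m t | p 0 = s}

/-- The **number of directed paths of length `m` from `s` to `t`** (`Set.ncard`, junk `0` for an
infinite set, which does not occur on a hard-sphere trajectory: in-degrees are at most `2`). As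
a function of `s` this is the depth-`m` ancestor multiset of `t`. [folklore] -/
def pathCount (G : Geometry d X) (ε : ℝ) (γ : ℝ → Config N d X) (a : ℝ) (m : ℕ) (s t : ℝ) : ℕ :=
  (dagPaths G ε γ a m s t).ncard

/-- The **backward cluster of the vertex `t` to depth `m`**: the collision times from which `t`
is reached by a directed path of length between `1` and `m`. [folklore] -/
def backwardClusterToDepth (G : Geometry d X) (ε : ℝ) (γ : ℝ → Config N d X) (a : ℝ) (m : ℕ)
    (t : ℝ) : Set ℝ :=
  {s | ∃ n, 1 ≤ n ∧ n ≤ m ∧ (dagPaths G ε γ a n s t).Nonempty}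

/-- The **ancestry** (full backward cluster) of the vertex `t`: all collision times from which
`t` is reached by a directed path of positive length (the transitive closure of `IsDagEdge`).
[folklore] -/
def ancestry (G : Geometry d X) (ε : ℝ) (γ : ℝ → Config N d X) (a : ℝ) (t : ℝ) : Set ℝ :=
  {s | ∃ n, 1 ≤ n ∧ (dagPaths G ε γ a n s t).Nonempty}

/-- The **path-pair census**: the number of ordered pairs of directed paths of prescribed
lengths `(ma, mb)`, from a COMMON start vertex, ending at `u` and at `v` respectively — the
count entering information-percolation bounds on a noisy DAG (Polyanskiy–Wu 2017 §5).
[folklore] -/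
def pathPairCount (G : Geometry d X) (ε : ℝ) (γ : ℝ → Config N d X) (a : ℝ) (ma mb : ℕ)
    (u v : ℝ) : ℕ :=
  {pq : (Fin (ma + 1) → ℝ) × (Fin (mb + 1) → ℝ) |
    pq.1 ∈ dagPathsTo G ε γ a ma u ∧ pq.2 ∈ dagPathsTo G ε γ a mb v ∧ pq.1 0 = pq.2 0}.ncard

/-- The **backward cluster to depth `m` of the partner `k`** of the collision at time `t`: the
parent `s₀` of `t` via `k` (the collision at which the current flight of `k` started, if it is
after `a`) together with the ancestors of `s₀` to depth `m - 1`; empty when `m = 0` or when `k`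
has not collided in `(a, t)`. [folklore] -/
def partnerCluster (G : Geometry d X) (ε : ℝ) (γ : ℝ → Config N d X) (a : ℝ) (m : ℕ) (k : Fin N)
    (t : ℝ) : Set ℝ :=
  {s | ∃ s₀, a < s₀ ∧ IsDagEdgeVia G ε γ k s₀ t ∧ ∃ n, n < m ∧ (dagPaths G ε γ a n s s₀).Nonempty}

/-- The collision at time `t` is **fresh to depth `m`**: the depth-`m` backward clusters of its
two partners are disjoint (no common collision in the last `m` generations of their histories
inside the window `(a, ∞)`). Vacuous off the collision times and for `m = 0`. [folklore] -/
def IsFresh (G : Geometry d X) (ε : ℝ) (γ : ℝ → Config N d X) (a : ℝ) (m : ℕ) (t : ℝ) : Prop :=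
  ∀ p ∈ contactPairs G ε (γ t),
    Disjoint (partnerCluster G ε γ a m p.1 t) (partnerCluster G ε γ a m p.2 t)

/-- The collision at time `t` is a **ring collision to depth `m`**: not fresh, i.e. the two
partners share a collision in the last `m` generations of their histories (recollisions and
short cycles of the collision history). [folklore] -/
def IsRing (G : Geometry d X) (ε : ℝ) (γ : ℝ → Config N d X) (a : ℝ) (m : ℕ) (t : ℝ) : Prop :=
  ¬ IsFresh G ε γ a m t

/-- The ancestry of the vertex `t` is a **tree to depth `m`**: every collision time is joined to
`t` by at most one directed path of length at most `m` (no two lineages of `t` of depth `≤ m`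
merge, i.e. no sphere met twice, directly or through intermediaries, within the last `m`
generations). Independent of `IsFresh` (a direct recollision of the two partners is a ring with
tree ancestry). [folklore] -/
def IsTreeToDepth (G : Geometry d X) (ε : ℝ) (γ : ℝ → Config N d X) (a : ℝ) (m : ℕ) (t : ℝ) :
    Prop :=
  ∀ s, {np : (n : ℕ) × (Fin (n + 1) → ℝ) | np.1 ≤ m ∧ np.2 ∈ dagPaths G ε γ a np.1 s t}.Subsingleton

variable {γ : ℝ → Config N d X} {a : ℝ}

/-- Membership in the paths ending at `t`. [folklore] -/
theorem mem_dagPathsTo {m : ℕ} {t : ℝ} {p : Fin (m + 1) → ℝ} :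
    p ∈ dagPathsTo G ε γ a m t ↔
      p (Fin.last m) = t ∧ ∀ r : Fin m, IsDagEdge G ε γ a (p r.castSucc) (p r.succ) :=
  Iff.rfl

/-- Membership in the paths from `s` to `t`. [folklore] -/
theorem mem_dagPaths {m : ℕ} {s t : ℝ} {p : Fin (m + 1) → ℝ} :
    p ∈ dagPaths G ε γ a m s t ↔ p ∈ dagPathsTo G ε γ a m t ∧ p 0 = s :=
  Iff.rfl

/-- The only path of length `0` ending at `t` is the constant one. [folklore] -/
theorem dagPathsTo_zero (t : ℝ) : dagPathsTo G ε γ a 0 t = {fun _ => t} := by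
  ext p
  rw [mem_dagPathsTo, mem_singleton_iff]
  constructor
  · rintro ⟨h0, -⟩
    funext r
    rw [Fin.fin_one_eq_zero r]
    exact h0
  · rintro rfl
    exact ⟨rfl, fun r => r.elim0⟩

/-- Paths of length `0` join a vertex to itself only. [folklore] -/
theorem dagPaths_zero_nonempty_iff {s t : ℝ} : (dagPaths G ε γ a 0 s t).Nonempty ↔ s = t := by
  constructor
  · rintro ⟨p, hp, hp0⟩
    rw [dagPathsTo_zero, mem_singleton_iff] at hp
    rw [← hp0, hp]
  · rintro rfl
    exact ⟨fun _ => s, by rw [dagPaths, mem_setOf_eq, dagPathsTo_zero]; exact ⟨rfl, rfl⟩⟩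

/-- **Paths of length one are edges.** [folklore] -/
theorem dagPaths_one_nonempty_iff {s t : ℝ} :
    (dagPaths G ε γ a 1 s t).Nonempty ↔ IsDagEdge G ε γ a s t := by
  constructor
  · rintro ⟨p, ⟨hlast, hedge⟩, hp0⟩
    have h := hedge 0
    have h1 : p (Fin.succ 0) = t := by rw [← hlast]; rfl
    rw [Fin.castSucc_zero, hp0, h1] at h
    exact h
  · intro h
    refine ⟨![s, t], ⟨rfl, fun r => ?_⟩, rfl⟩
    rw [Fin.fin_one_eq_zero r]
    exact h

/-- A directed path is strictly increasing in time. [folklore] -/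
theorem strictMono_of_mem_dagPathsTo {m : ℕ} {t : ℝ} {p : Fin (m + 1) → ℝ}
    (hp : p ∈ dagPathsTo G ε γ a m t) : StrictMono p :=
  Fin.strictMono_iff_lt_succ.2 fun r => (hp.2 r).lt.2

/-- Every vertex on a path ending at `t` (other than `t`) is an earlier collision time after `a`.
[folklore] -/
theorem lt_of_mem_dagPathsTo {m : ℕ} {t : ℝ} {p : Fin (m + 1) → ℝ} (hp : p ∈ dagPathsTo G ε γ a m t)
    (r : Fin m) : a < p r.castSucc ∧ p r.castSucc < t := by
  refine ⟨(hp.2 r).lt.1, ?_⟩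
  rw [← hp.1]
  exact strictMono_of_mem_dagPathsTo hp (Fin.castSucc_lt_last r)

/-- Ancestors are earlier collision times after the window start. [folklore] -/
theorem lt_of_mem_ancestry {s t : ℝ} (hs : s ∈ ancestry G ε γ a t) : a < s ∧ s < t := by
  obtain ⟨n, hn, p, hp, hp0⟩ := hs
  obtain ⟨n, rfl⟩ : ∃ k, n = k + 1 := ⟨n - 1, by omega⟩
  have h := lt_of_mem_dagPathsTo hp 0
  rw [Fin.castSucc_zero, hp0] at h
  exact h

/-- The depth-`m` backward cluster is part of the ancestry. [folklore] -/
theorem backwardClusterToDepth_subset_ancestry (m : ℕ) (t : ℝ) :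
    backwardClusterToDepth G ε γ a m t ⊆ ancestry G ε γ a t :=
  fun _ ⟨n, hn, _, hne⟩ => ⟨n, hn, hne⟩

/-- Backward clusters grow with the depth. [folklore] -/
theorem backwardClusterToDepth_mono {m m' : ℕ} (h : m ≤ m') (t : ℝ) :
    backwardClusterToDepth G ε γ a m t ⊆ backwardClusterToDepth G ε γ a m' t :=
  fun _ ⟨n, hn, hnm, hne⟩ => ⟨n, hn, hnm.trans h, hne⟩

/-- To depth one the backward cluster consists of the parents. [folklore] -/
theorem mem_backwardClusterToDepth_one {s t : ℝ} :
    s ∈ backwardClusterToDepth G ε γ a 1 t ↔ IsDagEdge G ε γ a s t := by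
  constructor
  · rintro ⟨n, hn, hn1, hne⟩
    obtain rfl : n = 1 := le_antisymm hn1 hn
    exact dagPaths_one_nonempty_iff.1 hne
  · exact fun h => ⟨1, le_rfl, le_rfl, dagPaths_one_nonempty_iff.2 h⟩

/-- Partner clusters grow with the depth. [folklore] -/
theorem partnerCluster_mono {m m' : ℕ} (h : m ≤ m') (k : Fin N) (t : ℝ) :
    partnerCluster G ε γ a m k t ⊆ partnerCluster G ε γ a m' k t :=
  fun _ ⟨s₀, hs₀, he, n, hn, hne⟩ => ⟨s₀, hs₀, he, n, hn.trans_le h, hne⟩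

/-- To depth `0` partner clusters are empty. [folklore] -/
@[simp]
theorem partnerCluster_zero (k : Fin N) (t : ℝ) : partnerCluster G ε γ a 0 k t = ∅ :=
  Set.eq_empty_iff_forall_notMem.2 fun _ ⟨_, _, _, _, hn, _⟩ => (Nat.not_lt_zero _ hn).elim

/-- To depth `1` the partner cluster of `k` is its parent vertex (if after `a`). [folklore] -/
theorem mem_partnerCluster_one {k : Fin N} {s t : ℝ} :
    s ∈ partnerCluster G ε γ a 1 k t ↔ a < s ∧ IsDagEdgeVia G ε γ k s t := by
  constructor
  · rintro ⟨s₀, hs₀, he, n, hn, hne⟩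
    obtain rfl : n = 0 := Nat.lt_one_iff.1 hn
    obtain rfl : s = s₀ := dagPaths_zero_nonempty_iff.1 hne
    exact ⟨hs₀, he⟩
  · rintro ⟨has, he⟩
    exact ⟨s, has, he, 0, Nat.zero_lt_one, dagPaths_zero_nonempty_iff.2 rfl⟩

/-- A partner cluster lies in the ancestry of the collision (plus nothing else): its members are
earlier collision times after `a`. [folklore] -/
theorem partnerCluster_subset_ancestry (m : ℕ) (k : Fin N) (t : ℝ) :
    partnerCluster G ε γ a m k t ⊆ ancestry G ε γ a t := by
  rintro s ⟨s₀, hs₀, he, n, hn, p, hp, hp0⟩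
  -- extend the path `s → ⋯ → s₀` by the edge `s₀ → t`
  refine ⟨n + 1, by omega, Fin.snoc p t, ⟨?_, fun r => ?_⟩, ?_⟩
  · exact Fin.snoc_last (α := fun _ => ℝ) t p
  · refine Fin.lastCases ?_ (fun r' => ?_) r
    · have h1 : (Fin.snoc p t : Fin (n + 2) → ℝ) (Fin.last n).castSucc = s₀ := by
        rw [Fin.snoc_castSucc]; exact hp.1
      have h2 : (Fin.snoc p t : Fin (n + 2) → ℝ) (Fin.last n).succ = t := by
        rw [Fin.succ_last]; exact Fin.snoc_last (α := fun _ => ℝ) t p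
      rw [h1, h2]
      exact ⟨hs₀, k, he⟩
    · have h1 : (Fin.snoc p t : Fin (n + 2) → ℝ) r'.castSucc.castSucc = p r'.castSucc :=
        Fin.snoc_castSucc (α := fun _ => ℝ) t p _
      have h2 : (Fin.snoc p t : Fin (n + 2) → ℝ) r'.castSucc.succ = p r'.succ := by
        rw [Fin.succ_castSucc]; exact Fin.snoc_castSucc (α := fun _ => ℝ) t p _
      rw [h1, h2]
      exact hp.2 r'
  · change (Fin.snoc p t : Fin (n + 2) → ℝ) (Fin.castSucc 0) = s
    rw [Fin.snoc_castSucc]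
    exact hp0

/-- Everything is fresh to depth `0`. [folklore] -/
theorem isFresh_zero (t : ℝ) : IsFresh G ε γ a 0 t := fun p _ => by simp

/-- Freshness is antitone in the depth: fresh to depth `m'` implies fresh to every smaller depth.
[folklore] -/
theorem IsFresh.mono {m m' : ℕ} (h : m ≤ m') {t : ℝ} (hf : IsFresh G ε γ a m' t) :
    IsFresh G ε γ a m t := fun p hp =>
  (hf p hp).mono (partnerCluster_mono h _ _) (partnerCluster_mono h _ _)

/-- Off the collision times every time is (vacuously) fresh. [folklore] -/
theorem isFresh_of_not_mem {t : ℝ} (ht : t ∉ collisionTimes G ε γ) (m : ℕ) : IsFresh G ε γ a m t := by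
  intro p hp
  rw [contactPairs_eq_empty_of_not_mem ht] at hp
  exact absurd hp (Finset.notMem_empty p)

/-- Every ancestry is a tree to depth `0`. [folklore] -/
theorem isTreeToDepth_zero (t : ℝ) : IsTreeToDepth G ε γ a 0 t := by
  rintro s ⟨n, p⟩ ⟨hn, hp⟩ ⟨n', p'⟩ ⟨hn', hp'⟩
  obtain rfl : n = 0 := Nat.le_zero.1 hn
  obtain rfl : n' = 0 := Nat.le_zero.1 hn'
  have h1 : p = fun _ => t := by
    have := (mem_dagPaths.1 hp).1
    rwa [dagPathsTo_zero, mem_singleton_iff] at this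
  have h2 : p' = fun _ => t := by
    have := (mem_dagPaths.1 hp').1
    rwa [dagPathsTo_zero, mem_singleton_iff] at this
  subst h1
  subst h2
  rfl

end Dag

namespace IsHardSphereTrajectory

variable [TopologicalSpace X] {G : Geometry d X} {ε : ℝ} {γ : ℝ → Config N d X}

/-- **In-degree at most two**: on a hard-sphere trajectory the parents of the collision of the
ordered pair `(i, j)` at time `t` are among the flight starts of `i` and of `j`. [folklore] -/
theorem isDagEdge_iff (h : IsHardSphereTrajectory G ε N γ) {a t : ℝ} {i j : Fin N}
    (hp : (i, j) ∈ contactPairs G ε (γ t)) {s : ℝ} :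
    IsDagEdge G ε γ a s t ↔ a < s ∧
      (s = flightStart G ε γ a i t ∧ IsDagEdgeVia G ε γ i s t ∨
        s = flightStart G ε γ a j t ∧ IsDagEdgeVia G ε γ j s t) := by
  constructor
  · rintro ⟨has, k, hk⟩
    have hk' : k = i ∨ k = j := (h.participates_iff hp).1 hk.2.2.1
    refine ⟨has, ?_⟩
    rcases hk' with rfl | rfl
    · exact Or.inl ⟨hk.eq_flightStart has (h.finite_collisionTimesOf_inter_Ioo _ a t), hk⟩
    · exact Or.inr ⟨hk.eq_flightStart has (h.finite_collisionTimesOf_inter_Ioo _ a t), hk⟩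
  · rintro ⟨has, ⟨-, he⟩ | ⟨-, he⟩⟩
    · exact ⟨has, i, he⟩
    · exact ⟨has, j, he⟩

/-- On a hard-sphere trajectory a collision has at most two parents in the DAG. [folklore] -/
theorem setOf_isDagEdge_subset (h : IsHardSphereTrajectory G ε N γ) {a t : ℝ} {i j : Fin N}
    (hp : (i, j) ∈ contactPairs G ε (γ t)) :
    {s | IsDagEdge G ε γ a s t} ⊆ {flightStart G ε γ a i t, flightStart G ε γ a j t} := by
  intro s hs
  rcases ((h.isDagEdge_iff hp).1 hs).2 with ⟨hs', -⟩ | ⟨hs', -⟩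
  · exact Or.inl hs'
  · exact Or.inr hs'

/-- On a hard-sphere trajectory the set of parents of a vertex is finite (at most two). [folklore] -/
theorem finite_setOf_isDagEdge (h : IsHardSphereTrajectory G ε N γ) (a t : ℝ) :
    {s | IsDagEdge G ε γ a s t}.Finite := by
  by_cases ht : t ∈ collisionTimes G ε γ
  · obtain ⟨⟨i, j⟩, hp⟩ := mem_collisionTimes_iff_contactPairs_nonempty.1 ht
    exact ((finite_singleton _).insert _).subset (h.setOf_isDagEdge_subset hp)
  · have : {s | IsDagEdge G ε γ a s t} = ∅ :=
      Set.eq_empty_iff_forall_notMem.2 fun s hs => ht hs.mem_collisionTimes.2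
    rw [this]
    exact finite_empty

end IsHardSphereTrajectory

/-! ## Coarse-graining of configurations -/

section Coarse

omit [Fintype d] in
/-- The **coarse-grained configuration**: positions seen through a coarse-graining map
`q : X → C` (cells of a mesh, or `id` for exact positions), velocities kept exact. [folklore] -/
def coarseConfig {C : Type*} (q : X → C) (z : Config N d X) : Fin N → C × EuclideanSpace ℝ d :=
  fun k => (q (z k).1, (z k).2)

omit [Fintype d] in
/-- Unfolding lemma for the coarse-grained configuration. [folklore] -/
@[simp]
theorem coarseConfig_apply {C : Type*} (q : X → C) (z : Config N d X) (k : Fin N) :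
    coarseConfig q z k = (q (z k).1, (z k).2) := rfl

omit [Fintype d] in
/-- Coarse-graining through the identity keeps the configuration (up to the canonical
identification). [folklore] -/
theorem coarseConfig_id (z : Config N d X) : coarseConfig id z = z := by
  funext k
  simp

omit [Fintype d] in
/-- The coarse-grained configuration is measurable in the configuration when the cell map is.
[folklore] -/
theorem measurable_coarseConfig [MeasurableSpace X] {C : Type*} [MeasurableSpace C] {q : X → C}
    (hq : Measurable q) : Measurable (coarseConfig (N := N) (d := d) q) := by
  refine measurable_pi_lambda _ fun k => ?_
  exact (hq.comp (measurable_pi_apply k).fst).prodMk (measurable_pi_apply k).snd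

end Coarse

/-- The **`r`-cells of the flat torus**: the coarse-graining map sending a point of `T^d` to the
integer vector `⌊x̃_i / r⌋` of its symmetric representative `x̃ = reprSym x ∈ (-1/2, 1/2]^d`
(a mesh of size `r`). [folklore] -/
def Torus.coarseCell {d : Type*} (r : ℝ) (x : UnitAddTorus d) : d → ℤ :=
  fun i => ⌊Torus.reprSym x i / r⌋

/-- The torus cell map is measurable. [folklore] -/
theorem Torus.measurable_coarseCell {d : Type*} (r : ℝ) :
    Measurable (Torus.coarseCell (d := d) r) := by
  refine measurable_pi_lambda _ fun i => ?_
  have h1 : Measurable fun x : UnitAddTorus d => Torus.reprSym x i :=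
    (measurable_pi_apply (X := fun _ : d => ℝ) i).comp
      ((WithLp.measurable_ofLp 2 (d → ℝ)).comp Torus.measurable_reprSym)
  exact Int.measurable_floor.comp (h1.div_const r)

/-! ## Along the hard-sphere flow: collision sums, the empirical collision measure, the `n`-th
collision of a particle and its coarse past, as functions of the initial datum -/

namespace HardSphereFlow

variable [MeasureSpace X] [TopologicalSpace X] {G : Geometry d X} {ε : ℝ}

/-- The collision pair sum along the orbit of the initial datum `z` under the flow `Φ`, the
summand seeing the time, the current (post-collisional) configuration and the ordered pair
(meaningful for `z ∈ Φ.good`). [folklore] -/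
def collisionPairSum {M : Type*} [AddCommMonoid M] (Φ : HardSphereFlow G ε N) (S : Set ℝ)
    (g : ℝ → Config N d X → Fin N → Fin N → M) (z : Config N d X) : M :=
  FluidPDE.collisionPairSum G ε (fun t => Φ.flow t z) S fun t i j => g t (Φ.flow t z) i j

/-- The **collision sum along the flow**: `Σ_{collisions of the orbit of z with times in S} F`
(requested as `collisionSum` by routes OneFlightGossip / KineticWindows). [folklore] -/
def collisionSum {M : Type*} [AddCommMonoid M] (Φ : HardSphereFlow G ε N) (S : Set ℝ)
    (F : HardSphereCollisionRecord d X N → M) (z : Config N d X) : M :=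
  FluidPDE.collisionSum G ε (fun t => Φ.flow t z) S F

/-- The **empirical collision measure** of the orbit of `z` over the times in `S`:
`Σ_{(t, i, j)} δ_{(t, x_i, ω, v_i⁻, v_j⁻)}` (UNNORMALISED; route CollisionMeasureChaos uses
`(ε/(N+1)) •` this with `S = Icc 0 τ`). [folklore] -/
def empiricalCollisionMeasure (Φ : HardSphereFlow G ε N) (S : Set ℝ) (z : Config N d X) :
    Measure (ℝ × X × EuclideanSpace ℝ d × EuclideanSpace ℝ d × EuclideanSpace ℝ d) :=
  collisionMeasure G ε (fun t => Φ.flow t z) S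

/-- The **time of the `n`-th collision of particle `i`** after time `0` along the orbit of `z`
(`n = 0` is the first; junk values off `Φ.good` and beyond the last collision). [folklore] -/
def nthCollisionTimeOf (Φ : HardSphereFlow G ε N) (i : Fin N) (n : ℕ) (z : Config N d X) : ℝ :=
  FluidPDE.nthCollisionTimeOf G ε (fun t => Φ.flow t z) 0 i n

/-- The **partner of `i` in its `n`-th collision** along the orbit of `z`. [folklore] -/
def nthPartnerOf (Φ : HardSphereFlow G ε N) (i : Fin N) (n : ℕ) (z : Config N d X) : Fin N :=
  partner G ε (Φ.flow (Φ.nthCollisionTimeOf i n z) z) i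

/-- The **record of the `n`-th collision of `i`** along the orbit of `z` (ordered pair
`(i, partner)`; impact vector, pre- and post-collisional velocities as in
`HardSphereCollisionRecord.ofConfig`). [folklore] -/
def nthRecordOf (Φ : HardSphereFlow G ε N) (i : Fin N) (n : ℕ) (z : Config N d X) :
    HardSphereCollisionRecord d X N :=
  HardSphereCollisionRecord.ofConfig G ε (Φ.flow (Φ.nthCollisionTimeOf i n z) z)
    (Φ.nthCollisionTimeOf i n z) i (Φ.nthPartnerOf i n z)

/-- The **coarse past of the `n`-th collision of `i`**, as a function of the initial datum `z`:
the `q`-coarse-grained configurations (all positions through `q`, exact velocities) of the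
system at the starts of the free flights of `i` and of its partner that end in this collision
(`flightStart` from time `0`). With `q = id` this is the pair of exact configurations at the two
flight starts. [folklore] -/
def coarsePastOf {C : Type*} (Φ : HardSphereFlow G ε N) (q : X → C) (i : Fin N) (n : ℕ)
    (z : Config N d X) :
    (Fin N → C × EuclideanSpace ℝ d) × (Fin N → C × EuclideanSpace ℝ d) :=
  (coarseConfig q (Φ.flow
      (flightStart G ε (fun t => Φ.flow t z) 0 i (Φ.nthCollisionTimeOf i n z)) z),
    coarseConfig q (Φ.flow
      (flightStart G ε (fun t => Φ.flow t z) 0 (Φ.nthPartnerOf i n z)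
        (Φ.nthCollisionTimeOf i n z)) z))

/-- The **σ-algebra of the coarse past** of the `n`-th collision of `i`: the σ-algebra on
initial data generated by `coarsePastOf Φ q i n` (`MeasurableSpace.comap`), a sub-σ-algebra of
the Borel σ-algebra as soon as that map is measurable (`coarsePastSigma_le`); conditional
expectations `MeasureTheory.condExp` given the coarse past are taken with respect to it.
[folklore] -/
abbrev coarsePastSigma {C : Type*} [MeasurableSpace C] (Φ : HardSphereFlow G ε N) (q : X → C)
    (i : Fin N) (n : ℕ) : MeasurableSpace (Config N d X) :=
  MeasurableSpace.comap (Φ.coarsePastOf q i n) inferInstance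

variable (Φ : HardSphereFlow G ε N)

/-- Unfolding lemma for the collision sum along the flow. [folklore] -/
theorem collisionSum_eq {M : Type*} [AddCommMonoid M] (S : Set ℝ)
    (F : HardSphereCollisionRecord d X N → M) (z : Config N d X) :
    Φ.collisionSum S F z = FluidPDE.collisionSum G ε (fun t => Φ.flow t z) S F := rfl

/-- The collision sum along the flow is a collision pair sum along the flow. [folklore] -/
theorem collisionSum_eq_collisionPairSum {M : Type*} [AddCommMonoid M] (S : Set ℝ)
    (F : HardSphereCollisionRecord d X N → M) (z : Config N d X) :
    Φ.collisionSum S F z =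
      Φ.collisionPairSum S (fun t w i j => F (HardSphereCollisionRecord.ofConfig G ε w t i j)) z :=
  rfl

/-- Unfolding lemma for the empirical collision measure. [folklore] -/
theorem empiricalCollisionMeasure_eq (S : Set ℝ) (z : Config N d X) :
    Φ.empiricalCollisionMeasure S z = collisionMeasure G ε (fun t => Φ.flow t z) S := rfl

/-- On the good set every bounded window carries finitely many collision times. [folklore] -/
theorem finite_collisionTimes_inter {z : Config N d X} (hz : z ∈ Φ.good) {S : Set ℝ} {a b : ℝ}
    (hS : S ⊆ Icc a b) : (collisionTimes G ε (fun t => Φ.flow t z) ∩ S).Finite :=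
  (Φ.isTrajectory z hz).finite_collisionTimes_inter_of_subset_Icc hS

/-- **The inline form of the routes, along the flow**: on the good set (the orbit stays in the
hard-sphere domain) the collision pair sum is
`∑ᶠ s ∈ collisionTimes ∩ S, ∑ i, ∑ j, if i ≠ j ∧ ‖x_i(s) - x_j(s)‖ = ε then g … else 0`.
[folklore] -/
theorem collisionPairSum_eq_finsum_ite {M : Type*} [AddCommMonoid M] {z : Config N d X}
    (hz : z ∈ Φ.good) (S : Set ℝ) (g : ℝ → Config N d X → Fin N → Fin N → M) :
    Φ.collisionPairSum S g z =
      ∑ᶠ s ∈ collisionTimes G ε (fun t => Φ.flow t z) ∩ S, ∑ i, ∑ j,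
        if i ≠ j ∧ ‖G.sepVec (Φ.flow s z i).1 (Φ.flow s z j).1‖ = ε then g s (Φ.flow s z) i j
        else 0 :=
  FluidPDE.collisionPairSum_eq_finsum_ite (fun t => (Φ.isTrajectory z hz).mem t) S _

/-- Integrals against the empirical collision measure of a bounded window are collision sums
along the flow (good initial data, measurable singletons in `X`). [folklore] -/
theorem integral_empiricalCollisionMeasure [MeasurableSingletonClass X] {E : Type*}
    [NormedAddCommGroup E] [NormedSpace ℝ E] [CompleteSpace E] {z : Config N d X}
    (hz : z ∈ Φ.good) {S : Set ℝ}
    {a b : ℝ} (hS : S ⊆ Icc a b)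
    (f : ℝ × X × EuclideanSpace ℝ d × EuclideanSpace ℝ d × EuclideanSpace ℝ d → E) :
    ∫ m, f m ∂Φ.empiricalCollisionMeasure S z = Φ.collisionSum S (fun c => f c.mark) z :=
  integral_collisionMeasure (Φ.finite_collisionTimes_inter hz hS) f

/-- Lower Lebesgue integrals against the empirical collision measure of a bounded window are
collision sums along the flow. [folklore] -/
theorem lintegral_empiricalCollisionMeasure [MeasurableSingletonClass X] {z : Config N d X}
    (hz : z ∈ Φ.good) {S : Set ℝ} {a b : ℝ} (hS : S ⊆ Icc a b)
    (f : ℝ × X × EuclideanSpace ℝ d × EuclideanSpace ℝ d × EuclideanSpace ℝ d → ℝ≥0∞) :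
    ∫⁻ m, f m ∂Φ.empiricalCollisionMeasure S z = Φ.collisionSum S (fun c => f c.mark) z :=
  lintegral_collisionMeasure (Φ.finite_collisionTimes_inter hz hS) f

/-- The empirical collision measure of a bounded window is a finite measure on the good set.
[folklore] -/
theorem isFiniteMeasure_empiricalCollisionMeasure {z : Config N d X} (hz : z ∈ Φ.good)
    {S : Set ℝ} {a b : ℝ} (hS : S ⊆ Icc a b) :
    IsFiniteMeasure (Φ.empiricalCollisionMeasure S z) :=
  isFiniteMeasure_collisionMeasure (Φ.finite_collisionTimes_inter hz hS)

/-- In a regular geometry, counting each collision of the orbit once over `[a, b]` gives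
`numCollisions`. [folklore] -/
theorem collisionSum_ite_lt_eq_numCollisions (hG : G.IsHardSphereRegular ε) {z : Config N d X}
    (hz : z ∈ Φ.good) (a b : ℝ) :
    Φ.collisionSum (Icc a b) (fun c => if c.fst < c.snd then (1 : ℕ) else 0) z =
      numCollisions G ε (fun t => Φ.flow t z) a b :=
  (Φ.isTrajectory z hz).collisionSum_ite_lt_eq_numCollisions hG a b

/-- The `n`-th partner is THE partner: on the good set, if the ordered pair `(i, j)` is in
contact at the `n`-th collision time of `i`, then `nthPartnerOf Φ i n z = j`. [folklore] -/
theorem nthPartnerOf_eq {z : Config N d X} (hz : z ∈ Φ.good) {i j : Fin N} {n : ℕ}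
    (hp : (i, j) ∈ contactPairs G ε (Φ.flow (Φ.nthCollisionTimeOf i n z) z)) :
    Φ.nthPartnerOf i n z = j :=
  ((Φ.isTrajectory z hz).partner_eq (t := Φ.nthCollisionTimeOf i n z) hp).1

/-- The coarse past generates a sub-σ-algebra of the ambient one as soon as the coarse-past map
is measurable. [folklore] -/
theorem coarsePastSigma_le {C : Type*} [MeasurableSpace C] {q : X → C} {i : Fin N} {n : ℕ}
    (h : Measurable (Φ.coarsePastOf q i n)) :
    Φ.coarsePastSigma q i n ≤ (inferInstance : MeasurableSpace (Config N d X)) :=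
  h.comap_le

/-- The coarse-past map is measurable with respect to the coarse-past σ-algebra (by
construction). [folklore] -/
theorem measurable_coarsePastOf_coarsePastSigma {C : Type*} [MeasurableSpace C] (q : X → C)
    (i : Fin N) (n : ℕ) :
    Measurable[Φ.coarsePastSigma q i n] (Φ.coarsePastOf q i n) :=
  comap_measurable _

end HardSphereFlow

end Kinetic

end

end Literature.Analysis.FluidPDE
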